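import Literature.Probability.RandomPlanarGeometry.HexSAWStripBetaContactDensity
import Literature.Probability.RandomPlanarGeometry.HexSAWStripBridgeContactLLN
import HarnessLib

/-!
# The surface contacts of a long critical β-walk CONCENTRATE at `θ_T · n` whenever the critical irreducible bridge kernel has a finite second
# contact moment — unconditionally at width two, at `((3 − √2)/4)·n` (module «BETA-CONTACT-LLN»)

Topic `Literature/Probability/RandomPlanarGeometry` (continues «BETA-CONTACT-DENSITY» `HexSAWStripBetaContactDensity.lean` — the contact-weighted pieces
`betaCon/noRenCon/headCon/hb0Con/tailCon`, the derived length split `HV.betaCon_eq_two_mul`, `HV.con_le`, `HV.tendsto_endContactTerms_div`,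
★ `HV.tendsto_beta_contacts_per_step` (`cβ(2m)/(2m·bℓ(2m)) → θ_T`); «CONTACT-LLN» `HexSAWStripBridgeContactLLN.lean` — `HV.hat_contactSqSlices_facts`,
★ `HV.tendsto_contactSq_per_step_sq` (`Ĉ²_D(k)/(n_k² D̂(k)) → θ_T²`, conditional on `hC2`), `HV.widthTwo_summable_contactSqIrr`; «BETA-LENGTH-SPLIT» /
«BETA-LENGTH-LAW» (a-p2 g22: `betaLenSum_eq_two_mul`, `tendsto_betaRenewalLen_even`, `exists_pos_tendsto_betaLenSum_even`, `summable_headLen/tailLen`,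
`exists_hb0Len_stripYT_le`); #633 `bridge_amplitudes_explicit`; «WIDTH-TWO-KERNEL» #715 (`W2.*`)).  Lane «pcv-sawmu» (CriticalPhenomena venture), a-p2 g24 —
the β-walk companion of «CONTACT-LLN» (HANDOFF-gen23 items 1 + 3 for the CONTACT count).  Sources of the SETTING / TEMPLATE: H. Duminil-Copin, A. Hammond,
CMP 324 (2013) §2.2 (renewal / bridge decomposition); N. R. Beaton et al., CMP 326 (2014) §3.2, Corollary 8 (the strip `S_T` at `(x_c, y_T)`; «there exists
a unique `y_T > 0` such that `ρ_T(y_T) = x_c`», arXiv v5 p. 12); W. Feller I (1968) XIII.3 (renewal with a delay), XIII.6 (mean and variance of the number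
of renewals; Chebyshev).  Nothing of the kind is printed for the strip.

## What is proved (namespace `Literature.Probability.RandomPlanarGeometry.SAW.HV`; `y = y_T = stripYT T`; `fℓ, dℓ, gℓ, nℓ` the head / middle-bridge / tail /
## no-renewal length slices of «BETA-LENGTH-SPLIT», `cfℓ, cdℓ, cgℓ, cnℓ` their contact-weighted and `c²fℓ, c²dℓ, c²gℓ, c²nℓ` their squared-contact-weighted versions)

* §1 `betaCon2`, `noRenCon2`, `headCon2`, `hb0Con2`, `tailCon2` (the five squared-contact slices); `hasDerivAt_sum_conVertexWeight`, `mul_derivConVertexSum_eq`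
  (`y∂_y Σ #top·w = Σ #top²·w`; the edge-sum version is «CONTACT-LLN»'s `hasDerivAt_contactSum`).
* §2 ★★ `betaCon2_eq_two_mul` (`T ≥ 1`, `y > 0`) — `y∂_y` of «BETA-CONTACT-DENSITY»'s `betaCon_eq_two_mul`:
  **`c²β(n) = 2( c²nℓ(n) + Σ_{a,b} Σ_{i+j+k=n} ( c²f·d·g + f·c²d·g + f·d·c²g + 2(cf·cd·g + cf·d·cg + f·cd·cg) ) )`** (the square of head + bridge + tail contacts).
* §3 `con2_le` (a piece with `i` vertices has `#top² ≤ i²`), `hb0Con2_eq_sum_LUset`, `sum_T3_eq_tsum`, `tendsto_tsum_zero_of_dominated` (plumbing).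
* §4 (`T ≥ 2`) ★ `tendsto_endContactSqTerms_div_sq` — the FIVE terms `c²f·d·g`, `f·d·c²g`, `cf·cd·g`, `cf·d·cg`, `f·cd·cg` are `o(m²)`: Tannery over `(i,k) ∈ ℕ²`
  with the ZERO limit, dominated by `fℓ_a(i)·K·gℓ_b(k)` (`#top ≤ #vertices ≤ 2m` on each piece) — the head and tail carry `O(1)` contacts in every moment that
  matters here, with NO moment hypothesis on the head/tail pieces; ★★ `tendsto_midContactSqTerm_even`, `tendsto_midContactSqSum_div_sq` (conditional on `hC2`) —
  the surviving term: `(1/(2m)²) Σ_{i+j+k=2m} fℓ_a(i) c²dℓ_{ab}(j) gℓ_b(k) → Fℓ_a · θ_T² · (2u_aℓ_b/⟨ℓ,M̄_len u⟩) · Gℓ_b`.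
* §5 (`T ≥ 2`; `u`, `ℓ` ANY positive fixed vectors of `Iinf T y_T`; `θ_T := ⟨ℓ, C̄_M u⟩/⟨ℓ, M̄_len u⟩` inline as in #687; the first three CONDITIONAL on the explicit
  hypothesis `hC2 : ∀ a b, Summable (k ↦ Ĉ²_M(k)_{ab})` at `y_T` — OPEN for `T ≥ 3`, discharged at `T = 2` by «CONTACT-LLN»):
  ★★★ `tendsto_betaCon2_div_sq` — `c²β(2m)/((2m)²·bℓ(2m)) → θ_T²`; ★★★★ `tendsto_beta_contacts_variance` — `Σ_{β-walks, 2m vertices}(#top − θ_T·2m)²·w/((2m)²·bℓ(2m)) → 0`;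
  ★★★★ `tendsto_beta_contacts_deviation` — for every `ε > 0`, `(Σ_{β-walks with 2m vertices, |#top/(2m) − θ_T| ≥ ε} w)/bℓ(2m) → 0` (Chebyshev);
  ★★★★ `widthTwo_beta_contacts_deviation` — **`T = 2`, UNCONDITIONAL: `(Σ_{β-walks of S₂ with 2m vertices and |#top/(2m) − (3 − √2)/4| ≥ ε} x_c^{2m} y₂^{#top}) / bℓ₂(2m) → 0`**:
  the surface contacts of a long critical width-two β-walk concentrate at `((3 − √2)/4)·n = 0.3964…·n` — the same density as the bridges («CONTACT-LLN»).

Label: LANE THEOREM (own result of lane «pcv-sawmu», a-p2 g24, 2026-08-27); classical template = Leibniz rule on the length split + Tannery + Feller XIII.6 +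
Chebyshev.  NOT claimed: `hC2` for any `T ≥ 3`, a CLT, the linear variance law, odd vertex counts (`bℓ_T(2m+1) = 0`), `T = 1`.
-/

noncomputable section

namespace Literature.Probability.RandomPlanarGeometry.SAW

open Finset Filter Topology Matrix BigOperators
open Literature.Analysis.Matrix Literature.Probability.Process Literature.Probability.LatticeModels Literature.Probability.Percolation

namespace HV

variable {T : ℕ}

/-! ### §1 The squared-contact pieces and the second `y∂_y` -/

/-- `c²β_T(n)(y) := Σ_{β-walks with n vertices} #top² · x_c^n y^{#top}`. [cite: BeatonBousquetMelouDeGierDuminilCopinGuttmann2014, §3.2; lane «pcv-sawmu» a-p2 g24] -/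
def betaCon2 (T n : ℕ) (y : ℝ) : ℝ := ∑ l ∈ betaLen T n n, (topCnt T l : ℝ) ^ 2 * (hexCriticalFugacity ^ l.length * y ^ topCnt T l)

/-- Squared-contact no-renewal slice. [cite: DuminilCopinHammond2013, §2.2; lane «pcv-sawmu» a-p2 g24] -/
def noRenCon2 (T n : ℕ) (y : ℝ) : ℝ :=
  ∑ l ∈ (noRenA T n).filter (fun l => l.length = n), (topCnt T l : ℝ) ^ 2 * (hexCriticalFugacity ^ l.length * y ^ topCnt T l)

/-- Squared-contact head slice. [cite: DuminilCopinHammond2013, §2.2; lane «pcv-sawmu» a-p2 g24] -/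
def headCon2 (T i : ℕ) (c : ℤ) (y : ℝ) : ℝ :=
  ∑ h ∈ (headN T i c).filter (fun h => h.length = i), (topCnt T h : ℝ) ^ 2 * (hexCriticalFugacity ^ h.length * y ^ topCnt T h)

/-- Squared-contact middle slice. [cite: DuminilCopinHammond2013, §2.2; lane «pcv-sawmu» a-p2 g24] -/
def hb0Con2 (T j : ℕ) (c e : ℤ) (y : ℝ) : ℝ :=
  ∑ b ∈ (HB0 T j c e).filter (fun b => b.length = j + 1), (topCnt T b.tail : ℝ) ^ 2 * wD T y b

/-- Squared-contact tail slice. [cite: DuminilCopinHammond2013, §2.2; lane «pcv-sawmu» a-p2 g24] -/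
def tailCon2 (T k : ℕ) (e : ℤ) (y : ℝ) : ℝ :=
  ∑ g ∈ (tailN T k e).filter (fun g => g.length = k + 1), (topCnt T g.tail : ℝ) ^ 2 * wD T y g

section Deriv

/-- `k · y^{k−1} · y = k · y^k` (plumbing). [cite: Feller1968, XIII.3; lane plumbing a-p2 g24] -/
private theorem natMul_pow_pred_mul₃ (k : ℕ) (y : ℝ) : (k : ℝ) * y ^ (k - 1) * y = (k : ℝ) * y ^ k := by
  rcases k with _ | k
  · simp
  · rw [Nat.add_sub_cancel, mul_assoc, ← pow_succ]

/-- Derivative of a contact-weighted vertex sum `Σ #top · x_c^{|l|} y^{#top}` (plumbing). [cite: BeatonBousquetMelouDeGierDuminilCopinGuttmann2014, §3.2; lane plumbing a-p2 g24] -/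
theorem hasDerivAt_sum_conVertexWeight (S : Finset (List HV)) (y : ℝ) :
    HasDerivAt (fun y => ∑ l ∈ S, (topCnt T l : ℝ) * (hexCriticalFugacity ^ l.length * y ^ topCnt T l))
      (∑ l ∈ S, (topCnt T l : ℝ) * (hexCriticalFugacity ^ l.length * ((topCnt T l : ℝ) * y ^ (topCnt T l - 1)))) y :=
  HasDerivAt.fun_sum fun _ _ => ((hasDerivAt_pow _ y).const_mul _).const_mul _

/-- `y ∂_y Σ #top · x^{|l|} y^{#top} = Σ #top² · x^{|l|} y^{#top}` (plumbing). [cite: BeatonBousquetMelouDeGierDuminilCopinGuttmann2014, §3.2; lane plumbing a-p2 g24] -/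
theorem mul_derivConVertexSum_eq (S : Finset (List HV)) (y : ℝ) :
    y * ∑ l ∈ S, (topCnt T l : ℝ) * (hexCriticalFugacity ^ l.length * ((topCnt T l : ℝ) * y ^ (topCnt T l - 1))) =
      ∑ l ∈ S, (topCnt T l : ℝ) ^ 2 * (hexCriticalFugacity ^ l.length * y ^ topCnt T l) := by
  rw [mul_sum]
  refine sum_congr rfl fun l _ => ?_
  calc y * ((topCnt T l : ℝ) * (hexCriticalFugacity ^ l.length * ((topCnt T l : ℝ) * y ^ (topCnt T l - 1))))
      = (topCnt T l : ℝ) * hexCriticalFugacity ^ l.length * ((topCnt T l : ℝ) * y ^ (topCnt T l - 1) * y) := by ring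
    _ = _ := by rw [natMul_pow_pred_mul₃]; ring

end Deriv

/-! ### §2 The second derived split: `(c_h + c_b + c_g)² ` expanded over the pieces -/

section Split

set_option maxHeartbeats 400000 in -- headroom (lit-1 g29 probe 08:38Z: 140–180k of the 200k default; LANE NOTICE #11)
/-- ★★ **THE SQUARED-CONTACT LENGTH SPLIT OF THE β-WALKS** (`T ≥ 1`, `y > 0`): `y∂_y` of «BETA-CONTACT-DENSITY»'s `betaCon_eq_two_mul`:
`c²β(n) = 2( c²nℓ(n) + Σ_{a,b}Σ_{i+j+k=n} ( c²f·d·g + f·c²d·g + f·d·c²g + 2(cf·cd·g + cf·d·cg + f·cd·cg) ) )` — the square of the contacts of a β-walk,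
expanded over head, middle bridge and tail. [cite: DuminilCopinHammond2013, §2.2; BeatonBousquetMelouDeGierDuminilCopinGuttmann2014, §3.2; lane «pcv-sawmu» a-p2 g24 — own] -/
theorem betaCon2_eq_two_mul (hT : 1 ≤ T) {y : ℝ} (hy : 0 < y) (n : ℕ) :
    betaCon2 T n y = 2 * (noRenCon2 T n y + ∑ a : Fin (2 * T), ∑ b : Fin (2 * T), ∑ t ∈ T3 n,
      (headCon2 T t.1 (a : ℕ) y * hb0Len T t.2.1 (a : ℕ) (b : ℕ) y * tailLen T t.2.2 (b : ℕ) y +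
        headLen T t.1 (a : ℕ) y * hb0Con2 T t.2.1 (a : ℕ) (b : ℕ) y * tailLen T t.2.2 (b : ℕ) y +
        headLen T t.1 (a : ℕ) y * hb0Len T t.2.1 (a : ℕ) (b : ℕ) y * tailCon2 T t.2.2 (b : ℕ) y +
        2 * (headCon T t.1 (a : ℕ) y * hb0Con T t.2.1 (a : ℕ) (b : ℕ) y * tailLen T t.2.2 (b : ℕ) y +
          headCon T t.1 (a : ℕ) y * hb0Len T t.2.1 (a : ℕ) (b : ℕ) y * tailCon T t.2.2 (b : ℕ) y +
          headLen T t.1 (a : ℕ) y * hb0Con T t.2.1 (a : ℕ) (b : ℕ) y * tailCon T t.2.2 (b : ℕ) y))) := by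
  -- derivative sums of all pieces
  set dB : ℝ → ℝ := fun y => ∑ l ∈ betaLen T n n,
    (topCnt T l : ℝ) * (hexCriticalFugacity ^ l.length * ((topCnt T l : ℝ) * y ^ (topCnt T l - 1))) with hdB
  set dN : ℝ → ℝ := fun y => ∑ l ∈ (noRenA T n).filter (fun l => l.length = n),
    (topCnt T l : ℝ) * (hexCriticalFugacity ^ l.length * ((topCnt T l : ℝ) * y ^ (topCnt T l - 1))) with hdN
  set dF : ℕ → ℤ → ℝ → ℝ := fun i c y => ∑ h ∈ (headN T i c).filter (fun h => h.length = i),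
    hexCriticalFugacity ^ h.length * ((topCnt T h : ℝ) * y ^ (topCnt T h - 1)) with hdF
  set dCF : ℕ → ℤ → ℝ → ℝ := fun i c y => ∑ h ∈ (headN T i c).filter (fun h => h.length = i),
    (topCnt T h : ℝ) * (hexCriticalFugacity ^ h.length * ((topCnt T h : ℝ) * y ^ (topCnt T h - 1))) with hdCF
  set dD : ℕ → ℤ → ℤ → ℝ → ℝ := fun j c e y => ∑ b ∈ (HB0 T j c e).filter (fun b => b.length = j + 1),
    hexCriticalFugacity ^ (b.length - 1) * ((topCnt T b.tail : ℝ) * y ^ (topCnt T b.tail - 1)) with hdD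
  set dCD : ℕ → ℤ → ℤ → ℝ → ℝ := fun j c e y => ∑ b ∈ (HB0 T j c e).filter (fun b => b.length = j + 1),
    (topCnt T b.tail : ℝ) * (hexCriticalFugacity ^ (b.length - 1) * ((topCnt T b.tail : ℝ) * y ^ (topCnt T b.tail - 1))) with hdCD
  set dG : ℕ → ℤ → ℝ → ℝ := fun k e y => ∑ g ∈ (tailN T k e).filter (fun g => g.length = k + 1),
    hexCriticalFugacity ^ (g.length - 1) * ((topCnt T g.tail : ℝ) * y ^ (topCnt T g.tail - 1)) with hdG
  set dCG : ℕ → ℤ → ℝ → ℝ := fun k e y => ∑ g ∈ (tailN T k e).filter (fun g => g.length = k + 1),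
    (topCnt T g.tail : ℝ) * (hexCriticalFugacity ^ (g.length - 1) * ((topCnt T g.tail : ℝ) * y ^ (topCnt T g.tail - 1))) with hdCG
  have hF : ∀ i (c : ℤ), HasDerivAt (fun y => headLen T i c y) (dF i c y) y := fun i c => by
    unfold headLen headLenN; exact hasDerivAt_sum_vertexWeight _ y
  have hCF : ∀ i (c : ℤ), HasDerivAt (fun y => headCon T i c y) (dCF i c y) y := fun i c => by
    unfold headCon; exact hasDerivAt_sum_conVertexWeight _ y
  have hD : ∀ j (c e : ℤ), HasDerivAt (fun y => hb0Len T j c e y) (dD j c e y) y := fun j c e => by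
    unfold hb0Len hb0LenN; exact hasDerivAt_sum_wD _ y
  have hCD : ∀ j (c e : ℤ), HasDerivAt (fun y => hb0Con T j c e y) (dCD j c e y) y := fun j c e => by
    unfold hb0Con; exact hasDerivAt_contactSum _ y
  have hG : ∀ k (e : ℤ), HasDerivAt (fun y => tailLen T k e y) (dG k e y) y := fun k e => by
    unfold tailLen tailLenN; exact hasDerivAt_sum_wD _ y
  have hCG : ∀ k (e : ℤ), HasDerivAt (fun y => tailCon T k e y) (dCG k e y) y := fun k e => by
    unfold tailCon; exact hasDerivAt_contactSum _ y
  have hLHS : HasDerivAt (fun y => betaCon T n y) (dB y) y := by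
    unfold betaCon; exact hasDerivAt_sum_conVertexWeight _ y
  have hN : HasDerivAt (fun y => noRenCon T n y) (dN y) y := by
    unfold noRenCon; exact hasDerivAt_sum_conVertexWeight _ y
  -- derivative of each summand of the split
  have hterm : ∀ (a b : Fin (2 * T)) (t : ℕ × ℕ × ℕ),
      HasDerivAt (fun y => headCon T t.1 (a : ℕ) y * hb0Len T t.2.1 (a : ℕ) (b : ℕ) y * tailLen T t.2.2 (b : ℕ) y +
          headLen T t.1 (a : ℕ) y * hb0Con T t.2.1 (a : ℕ) (b : ℕ) y * tailLen T t.2.2 (b : ℕ) y +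
          headLen T t.1 (a : ℕ) y * hb0Len T t.2.1 (a : ℕ) (b : ℕ) y * tailCon T t.2.2 (b : ℕ) y)
        (((dCF t.1 (a : ℕ) y * hb0Len T t.2.1 (a : ℕ) (b : ℕ) y + headCon T t.1 (a : ℕ) y * dD t.2.1 (a : ℕ) (b : ℕ) y) *
              tailLen T t.2.2 (b : ℕ) y + headCon T t.1 (a : ℕ) y * hb0Len T t.2.1 (a : ℕ) (b : ℕ) y * dG t.2.2 (b : ℕ) y) +
          ((dF t.1 (a : ℕ) y * hb0Con T t.2.1 (a : ℕ) (b : ℕ) y + headLen T t.1 (a : ℕ) y * dCD t.2.1 (a : ℕ) (b : ℕ) y) *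
              tailLen T t.2.2 (b : ℕ) y + headLen T t.1 (a : ℕ) y * hb0Con T t.2.1 (a : ℕ) (b : ℕ) y * dG t.2.2 (b : ℕ) y) +
          ((dF t.1 (a : ℕ) y * hb0Len T t.2.1 (a : ℕ) (b : ℕ) y + headLen T t.1 (a : ℕ) y * dD t.2.1 (a : ℕ) (b : ℕ) y) *
              tailCon T t.2.2 (b : ℕ) y + headLen T t.1 (a : ℕ) y * hb0Len T t.2.1 (a : ℕ) (b : ℕ) y * dCG t.2.2 (b : ℕ) y)) y :=
    fun a b t =>
      ((((hCF t.1 (a : ℕ)).mul (hD t.2.1 (a : ℕ) (b : ℕ))).mul (hG t.2.2 (b : ℕ))).add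
        (((hF t.1 (a : ℕ)).mul (hCD t.2.1 (a : ℕ) (b : ℕ))).mul (hG t.2.2 (b : ℕ)))).add
        (((hF t.1 (a : ℕ)).mul (hD t.2.1 (a : ℕ) (b : ℕ))).mul (hCG t.2.2 (b : ℕ)))
  have hsum3 := HasDerivAt.fun_sum (u := (Finset.univ : Finset (Fin (2 * T)))) fun a _ =>
    HasDerivAt.fun_sum (u := (Finset.univ : Finset (Fin (2 * T)))) fun b _ =>
      HasDerivAt.fun_sum (u := T3 n) fun t _ => hterm a b t
  have hRHS := (hN.add hsum3).const_mul 2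
  have hEq : (fun y => 2 * (noRenCon T n y + ∑ a : Fin (2 * T), ∑ b : Fin (2 * T), ∑ t ∈ T3 n,
      (headCon T t.1 (a : ℕ) y * hb0Len T t.2.1 (a : ℕ) (b : ℕ) y * tailLen T t.2.2 (b : ℕ) y +
        headLen T t.1 (a : ℕ) y * hb0Con T t.2.1 (a : ℕ) (b : ℕ) y * tailLen T t.2.2 (b : ℕ) y +
        headLen T t.1 (a : ℕ) y * hb0Len T t.2.1 (a : ℕ) (b : ℕ) y * tailCon T t.2.2 (b : ℕ) y))) =ᶠ[𝓝 y] (fun y => betaCon T n y) := by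
    filter_upwards [Ioi_mem_nhds hy] with y' hy'
    rw [betaCon_eq_two_mul hT hy' n]
  have huniq := hLHS.unique (hRHS.congr_of_eventuallyEq hEq.symm)
  -- multiply by `y`
  have eB : y * dB y = betaCon2 T n y := mul_derivConVertexSum_eq _ y
  have eN : y * dN y = noRenCon2 T n y := mul_derivConVertexSum_eq _ y
  have eF : ∀ i (c : ℤ), y * dF i c y = headCon T i c y := fun i c => mul_derivVertexSum_eq _ y
  have eCF : ∀ i (c : ℤ), y * dCF i c y = headCon2 T i c y := fun i c => mul_derivConVertexSum_eq _ y
  have eD : ∀ j (c e : ℤ), y * dD j c e y = hb0Con T j c e y := fun j c e => mul_derivSum_eq_contactSum _ y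
  have eCD : ∀ j (c e : ℤ), y * dCD j c e y = hb0Con2 T j c e y := fun j c e => mul_derivContactSum_eq _ y
  have eG : ∀ k (e : ℤ), y * dG k e y = tailCon T k e y := fun k e => mul_derivSum_eq_contactSum _ y
  have eCG : ∀ k (e : ℤ), y * dCG k e y = tailCon2 T k e y := fun k e => mul_derivContactSum_eq _ y
  rw [← eB, huniq, ← eN]
  simp only [← eF, ← eCF, ← eD, ← eCD, ← eG, ← eCG]
  rw [mul_left_comm]
  congr 1
  rw [mul_add]
  congr 1
  rw [Finset.mul_sum]
  refine sum_congr rfl fun a _ => ?_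
  rw [Finset.mul_sum]
  refine sum_congr rfl fun b _ => ?_
  rw [Finset.mul_sum]
  refine sum_congr rfl fun t _ => ?_
  ring

end Split

/-! ### §3 Bounds and the `T3`-sum as a `tsum` -/

section Bounds

variable {y : ℝ}

/-- `0 ≤ c²fℓ_c(i) ≤ i²·fℓ_c(i)`, `0 ≤ c²dℓ_{ce}(j) ≤ j²·dℓ_{ce}(j)`, `0 ≤ c²gℓ_e(k) ≤ k²·gℓ_e(k)`, `0 ≤ c²nℓ(n) ≤ n²·nℓ(n)` for `y ≥ 0` (plumbing).
[cite: BeatonBousquetMelouDeGierDuminilCopinGuttmann2014, §3.2; lane plumbing a-p2 g24] -/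
theorem con2_le (hy : 0 ≤ y) (i j k n : ℕ) (c e : ℤ) :
    (0 ≤ headCon2 T i c y ∧ headCon2 T i c y ≤ (i : ℝ) ^ 2 * headLen T i c y) ∧
      (0 ≤ hb0Con2 T j c e y ∧ hb0Con2 T j c e y ≤ (j : ℝ) ^ 2 * hb0Len T j c e y) ∧
      (0 ≤ tailCon2 T k e y ∧ tailCon2 T k e y ≤ (k : ℝ) ^ 2 * tailLen T k e y) ∧
      (0 ≤ noRenCon2 T n y ∧ noRenCon2 T n y ≤ (n : ℝ) ^ 2 * noRenLen T n y) := by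
  have hx := hexCriticalFugacity_pos_lt_one.1.le
  have hw0 : ∀ l : List HV, 0 ≤ hexCriticalFugacity ^ l.length * y ^ topCnt T l := fun l => mul_nonneg (pow_nonneg hx _) (pow_nonneg hy _)
  refine ⟨⟨sum_nonneg fun l _ => mul_nonneg (sq_nonneg _) (hw0 l), ?_⟩,
    ⟨sum_nonneg fun l _ => mul_nonneg (sq_nonneg _) (wD_nonneg T hy _), ?_⟩,
    ⟨sum_nonneg fun l _ => mul_nonneg (sq_nonneg _) (wD_nonneg T hy _), ?_⟩,
    ⟨sum_nonneg fun l _ => mul_nonneg (sq_nonneg _) (hw0 l), ?_⟩⟩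
  · rw [headCon2, headLen, headLenN, mul_sum]
    refine sum_le_sum fun l hl => mul_le_mul_of_nonneg_right ?_ (hw0 l)
    rw [mem_filter] at hl
    have h1 : (topCnt T l : ℝ) ≤ i := by exact_mod_cast (topCnt_le_length T l).trans hl.2.le
    exact pow_le_pow_left₀ (Nat.cast_nonneg _) h1 2
  · rw [hb0Con2, hb0Len, hb0LenN, mul_sum]
    refine sum_le_sum fun l hl => mul_le_mul_of_nonneg_right ?_ (wD_nonneg T hy _)
    rw [mem_filter] at hl
    have h := topCnt_le_length T l.tail
    rw [List.length_tail] at h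
    have h1 : (topCnt T l.tail : ℝ) ≤ j := by exact_mod_cast (show topCnt T l.tail ≤ j by omega)
    exact pow_le_pow_left₀ (Nat.cast_nonneg _) h1 2
  · rw [tailCon2, tailLen, tailLenN, mul_sum]
    refine sum_le_sum fun l hl => mul_le_mul_of_nonneg_right ?_ (wD_nonneg T hy _)
    rw [mem_filter] at hl
    have h := topCnt_le_length T l.tail
    rw [List.length_tail] at h
    have h1 : (topCnt T l.tail : ℝ) ≤ k := by exact_mod_cast (show topCnt T l.tail ≤ k by omega)
    exact pow_le_pow_left₀ (Nat.cast_nonneg _) h1 2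
  · rw [noRenCon2, noRenLen, mul_sum]
    refine sum_le_sum fun l hl => mul_le_mul_of_nonneg_right ?_ (hw0 l)
    rw [mem_filter] at hl
    have h1 : (topCnt T l : ℝ) ≤ n := by exact_mod_cast (topCnt_le_length T l).trans hl.2.le
    exact pow_le_pow_left₀ (Nat.cast_nonneg _) h1 2

/-- For `j ≥ 1`: `c²dℓ_{ce}(j) = Σ_{LUset T j j c e} #top²·wD` (plumbing). [cite: DuminilCopinHammond2013, §2.2; lane plumbing a-p2 g24] -/
theorem hb0Con2_eq_sum_LUset {j : ℕ} (hj : 1 ≤ j) (c e : ℤ) (y : ℝ) :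
    hb0Con2 T j c e y = ∑ l ∈ LUset T j (j : ℤ) c e, (topCnt T l.tail : ℝ) ^ 2 * wD T y l := by
  rw [hb0Con2]
  refine sum_congr ?_ fun _ _ => rfl
  ext b
  simp only [HB0, LUset, HBab, mem_filter, hlen]
  constructor
  · rintro ⟨⟨hB, hd, hl⟩, hlen⟩
    exact ⟨⟨hB, by omega, hd, hl⟩, by rw [hlen]; push_cast; ring⟩
  · rintro ⟨⟨hB, -, hd, hl⟩, hlen⟩
    exact ⟨⟨hB, hd, hl⟩, by have := hlen; omega⟩

/-- A `T3(2m)`-sum is a `tsum` over the outer lengths `(i,k) ∈ ℕ²` (plumbing). [cite: DuminilCopinHammond2013, §2.2; lane plumbing a-p2 g24] -/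
theorem sum_T3_eq_tsum (m : ℕ) (F : ℕ → ℕ → ℕ → ℝ) :
    (∑ t ∈ T3 (2 * m), F t.1 t.2.1 t.2.2) = ∑' p : ℕ × ℕ, (if p.1 + p.2 ≤ 2 * m then F p.1 (2 * m - p.1 - p.2) p.2 else 0) := by
  classical
  have hinj : Set.InjOn (fun t : ℕ × ℕ × ℕ => (t.1, t.2.2)) (T3 (2 * m) : Set (ℕ × ℕ × ℕ)) := by
    intro t ht t' ht' h
    rw [mem_coe, mem_T3] at ht ht'
    simp only [Prod.mk.injEq] at h
    refine Prod.ext h.1 (Prod.ext ?_ h.2)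
    omega
  rw [tsum_eq_sum (s := (T3 (2 * m)).image fun t => (t.1, t.2.2)) (fun p hp => ?_)]
  · rw [sum_image hinj]
    refine sum_congr rfl fun t ht => ?_
    rw [mem_T3] at ht
    rw [if_pos (by simp only; omega)]
    have hj : 2 * m - t.1 - t.2.2 = t.2.1 := by omega
    simp only [hj]
  · rw [if_neg]
    intro hle
    apply hp
    rw [mem_image]
    exact ⟨(p.1, 2 * m - p.1 - p.2, p.2), mem_T3.2 (by simp only; omega), rfl⟩

/-- Tannery with the zero limit (plumbing). [cite: Feller1968, XIII.3; lane plumbing a-p2 g24] -/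
theorem tendsto_tsum_zero_of_dominated {Φ : ℕ → ℕ × ℕ → ℝ} {bound : ℕ × ℕ → ℝ} (hs : Summable bound)
    (hpt : ∀ p, Tendsto (fun m => Φ m p) atTop (𝓝 0)) (hdom : ∀ᶠ m in atTop, ∀ p, ‖Φ m p‖ ≤ bound p) :
    Tendsto (fun m => ∑' p, Φ m p) atTop (𝓝 0) := by
  have h := tendsto_tsum_of_dominated_convergence (𝓕 := atTop) (f := Φ) (g := fun _ => (0 : ℝ)) (bound := bound) hs hpt hdom
  rwa [tsum_zero] at h

end Bounds

/-! ### §4 The five vanishing terms and the one surviving term of `c²β(2m)/(2m)²` -/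

section Tannery

variable {u ℓ : Fin (2 * T) → ℝ}

/-- A term bounded by `C/(2m)` tends to `0` (plumbing). [cite: Feller1968, XIII.3; lane plumbing a-p2 g24] -/
private theorem tendsto_zero_of_le_div {f : ℕ → ℝ} {C : ℝ} (h : ∀ m : ℕ, |f m| ≤ C * (1 / (2 * (m : ℝ)))) :
    Tendsto f atTop (𝓝 0) := by
  have hlim : Tendsto (fun m : ℕ => C * (1 / (2 * (m : ℝ)))) atTop (𝓝 (C * 0)) :=
    tendsto_const_nhds.mul (tendsto_const_nhds.div_atTop (Tendsto.const_mul_atTop two_pos tendsto_natCast_atTop_atTop))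
  rw [mul_zero] at hlim
  exact squeeze_zero_norm (fun m => by rw [Real.norm_eq_abs]; exact h m) hlim

set_option maxHeartbeats 400000 in -- five dominated-convergence arguments in one declaration (LANE NOTICE #11: headroom for the on-accept build)
/-- ★ **The five head/tail/cross second-moment terms are `o(m²)`** along even lengths: `Σ_{i+j+k=2m}` of `c²f·d·g`, `f·d·c²g`, `cf·cd·g`, `cf·d·cg`,
`f·cd·cg`, each divided by `(2m)²`, tends to `0` — Tannery with the zero limit, dominated by `fℓ_a(i)·K·gℓ_b(k)` (a piece with `i` vertices has at most
`i ≤ 2m` contacts). [cite: Feller1968, XIII.3 (renewal with a delay); DuminilCopinHammond2013, §2.2; lane «pcv-sawmu» a-p2 g24 — own] -/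
theorem tendsto_endContactSqTerms_div_sq (hT : 2 ≤ T) (a b : Fin (2 * T)) :
    Tendsto (fun m : ℕ => (∑ t ∈ T3 (2 * m), headCon2 T t.1 (a : ℕ) (stripYT T) * hb0Len T t.2.1 (a : ℕ) (b : ℕ) (stripYT T) *
        tailLen T t.2.2 (b : ℕ) (stripYT T)) / (2 * (m : ℝ)) ^ 2) atTop (𝓝 0) ∧
      Tendsto (fun m : ℕ => (∑ t ∈ T3 (2 * m), headLen T t.1 (a : ℕ) (stripYT T) * hb0Len T t.2.1 (a : ℕ) (b : ℕ) (stripYT T) *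
        tailCon2 T t.2.2 (b : ℕ) (stripYT T)) / (2 * (m : ℝ)) ^ 2) atTop (𝓝 0) ∧
      Tendsto (fun m : ℕ => (∑ t ∈ T3 (2 * m), headCon T t.1 (a : ℕ) (stripYT T) * hb0Con T t.2.1 (a : ℕ) (b : ℕ) (stripYT T) *
        tailLen T t.2.2 (b : ℕ) (stripYT T)) / (2 * (m : ℝ)) ^ 2) atTop (𝓝 0) ∧
      Tendsto (fun m : ℕ => (∑ t ∈ T3 (2 * m), headCon T t.1 (a : ℕ) (stripYT T) * hb0Len T t.2.1 (a : ℕ) (b : ℕ) (stripYT T) *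
        tailCon T t.2.2 (b : ℕ) (stripYT T)) / (2 * (m : ℝ)) ^ 2) atTop (𝓝 0) ∧
      Tendsto (fun m : ℕ => (∑ t ∈ T3 (2 * m), headLen T t.1 (a : ℕ) (stripYT T) * hb0Con T t.2.1 (a : ℕ) (b : ℕ) (stripYT T) *
        tailCon T t.2.2 (b : ℕ) (stripYT T)) / (2 * (m : ℝ)) ^ 2) atTop (𝓝 0) := by
  have hT1 : 1 ≤ T := by omega
  have hy : 0 ≤ stripYT T := (stripYT_pos hT1).le
  obtain ⟨K, hK⟩ := exists_hb0Len_stripYT_le hT1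
  have hK0 : 0 ≤ K := le_trans (pieceLen_nonneg hy 0 ((a : ℕ) : ℤ) ((b : ℕ) : ℤ)).2.1 (hK 0 a b)
  have hsF := summable_headLen hT ((a : ℕ) : ℤ)
  have hsG := summable_tailLen hT ((b : ℕ) : ℤ)
  have hF0 : ∀ i, 0 ≤ headLen T i (a : ℕ) (stripYT T) := fun i => (pieceLen_nonneg hy i ((a : ℕ) : ℤ) ((b : ℕ) : ℤ)).1
  have hG0 : ∀ k, 0 ≤ tailLen T k (b : ℕ) (stripYT T) := fun k => (pieceLen_nonneg hy k ((a : ℕ) : ℤ) ((b : ℕ) : ℤ)).2.2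
  have hD0 : ∀ j, 0 ≤ hb0Len T j (a : ℕ) (b : ℕ) (stripYT T) := fun j => (pieceLen_nonneg hy j ((a : ℕ) : ℤ) ((b : ℕ) : ℤ)).2.1
  have hbound : Summable (fun p : ℕ × ℕ => headLen T p.1 (a : ℕ) (stripYT T) * K * tailLen T p.2 (b : ℕ) (stripYT T)) :=
    Summable.mul_of_nonneg (f := fun i => headLen T i (a : ℕ) (stripYT T) * K) (g := fun k => tailLen T k (b : ℕ) (stripYT T))
      (hsF.mul_right K) hsG (fun i => mul_nonneg (hF0 i) hK0) hG0
  -- pieces' contact data (nonneg + bounds)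
  have hc := fun i j k => con_le (T := T) hy i j k 0 ((a : ℕ) : ℤ) ((b : ℕ) : ℤ)
  have hc2 := fun i j k => con2_le (T := T) hy i j k 0 ((a : ℕ) : ℤ) ((b : ℕ) : ℤ)
  -- the common domination bound: on `T3(2m)`, `i, j, k ≤ 2m`
  have hdom_of : ∀ (F : ℕ → ℕ → ℕ → ℝ), (∀ i j k, 0 ≤ F i j k) →
      (∀ i j k, F i j k ≤ ((i + j + k : ℕ) : ℝ) ^ 2 * (headLen T i (a : ℕ) (stripYT T) * K * tailLen T k (b : ℕ) (stripYT T))) →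
      ∀ᶠ m : ℕ in atTop, ∀ p : ℕ × ℕ, ‖(if p.1 + p.2 ≤ 2 * m then F p.1 (2 * m - p.1 - p.2) p.2 else 0) / (2 * (m : ℝ)) ^ 2‖ ≤
        headLen T p.1 (a : ℕ) (stripYT T) * K * tailLen T p.2 (b : ℕ) (stripYT T) := by
    intro F hF0' hFle
    filter_upwards [eventually_ge_atTop 1] with m hm p
    rw [Real.norm_eq_abs]
    have hm0 : (0 : ℝ) < (2 * (m : ℝ)) ^ 2 := by
      have h2m : (0:ℝ) < 2 * (m : ℝ) := by exact_mod_cast (show 0 < 2 * m by omega)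
      exact pow_pos h2m 2
    split_ifs with h
    · rw [abs_div, abs_of_nonneg (hF0' _ _ _), abs_of_pos hm0, div_le_iff₀ hm0]
      have hsum : p.1 + (2 * m - p.1 - p.2) + p.2 = 2 * m := by omega
      have h1 := hFle p.1 (2 * m - p.1 - p.2) p.2
      rw [hsum] at h1
      push_cast at h1
      linarith [h1]
    · rw [zero_div, abs_zero]; exact mul_nonneg (mul_nonneg (hF0 _) hK0) (hG0 _)
  -- generic pointwise step: `F i (2m−i−k) k ≤ C · (2m)` for fixed `(i,k)` gives `→ 0` after dividing by `(2m)²`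
  have hpt_of : ∀ (F : ℕ → ℕ → ℕ → ℝ), (∀ i j k, 0 ≤ F i j k) →
      (∀ i k, ∃ C : ℝ, 0 ≤ C ∧ ∀ j, F i j k ≤ C * ((j : ℝ) + 1)) →
      ∀ p : ℕ × ℕ, Tendsto (fun m : ℕ => (if p.1 + p.2 ≤ 2 * m then F p.1 (2 * m - p.1 - p.2) p.2 else 0) / (2 * (m : ℝ)) ^ 2) atTop (𝓝 0) := by
    intro F hF0' hC p
    obtain ⟨C, hC0, hCle⟩ := hC p.1 p.2
    -- `F/(2m)² ≤ C(2m+1)/(2m)² ≤ 2C/(2m)` for `m ≥ 1`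
    refine tendsto_zero_of_le_div (C := 2 * C) fun m => ?_
    rcases Nat.eq_zero_or_pos m with rfl | hm
    · simp
    have hm0 : (0 : ℝ) < 2 * (m : ℝ) := by exact_mod_cast (show 0 < 2 * m by omega)
    split_ifs with h
    · rw [abs_div, abs_of_nonneg (hF0' _ _ _), abs_of_pos (by positivity), div_le_iff₀ (by positivity)]
      have h1 := hCle (2 * m - p.1 - p.2)
      have hj : ((2 * m - p.1 - p.2 : ℕ) : ℝ) + 1 ≤ 2 * (m : ℝ) + 1 := by
        have : ((2 * m - p.1 - p.2 : ℕ) : ℝ) ≤ 2 * (m : ℝ) := by exact_mod_cast (show 2 * m - p.1 - p.2 ≤ 2 * m by omega)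
        linarith
      have h1m : (1 : ℝ) ≤ m := by exact_mod_cast hm
      calc F p.1 (2 * m - p.1 - p.2) p.2 ≤ C * (((2 * m - p.1 - p.2 : ℕ) : ℝ) + 1) := h1
        _ ≤ C * (2 * (m : ℝ) + 1) := mul_le_mul_of_nonneg_left hj hC0
        _ ≤ 2 * C * (1 / (2 * (m : ℝ))) * (2 * (m : ℝ)) ^ 2 := by
            field_simp
            nlinarith
    · rw [zero_div, abs_zero]; positivity
  -- assemble each term
  have hconv : ∀ (F : ℕ → ℕ → ℕ → ℝ), (∀ i j k, 0 ≤ F i j k) →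
      (∀ i j k, F i j k ≤ ((i + j + k : ℕ) : ℝ) ^ 2 * (headLen T i (a : ℕ) (stripYT T) * K * tailLen T k (b : ℕ) (stripYT T))) →
      (∀ i k, ∃ C : ℝ, 0 ≤ C ∧ ∀ j, F i j k ≤ C * ((j : ℝ) + 1)) →
      Tendsto (fun m : ℕ => (∑ t ∈ T3 (2 * m), F t.1 t.2.1 t.2.2) / (2 * (m : ℝ)) ^ 2) atTop (𝓝 0) := by
    intro F hF0' hFle hC
    have h := tendsto_tsum_zero_of_dominated hbound (hpt_of F hF0' hC) (hdom_of F hF0' hFle)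
    refine h.congr fun m => ?_
    rw [sum_T3_eq_tsum m F, ← tsum_div_const]
  -- now the five instances
  refine ⟨hconv (fun i j k => headCon2 T i (a : ℕ) (stripYT T) * hb0Len T j (a : ℕ) (b : ℕ) (stripYT T) * tailLen T k (b : ℕ) (stripYT T))
      (fun i j k => mul_nonneg (mul_nonneg (hc2 i j k).1.1 (hD0 _)) (hG0 _)) (fun i j k => ?_) (fun i k => ?_),
    hconv (fun i j k => headLen T i (a : ℕ) (stripYT T) * hb0Len T j (a : ℕ) (b : ℕ) (stripYT T) * tailCon2 T k (b : ℕ) (stripYT T))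
      (fun i j k => mul_nonneg (mul_nonneg (hF0 _) (hD0 _)) (hc2 i j k).2.2.1.1) (fun i j k => ?_) (fun i k => ?_),
    hconv (fun i j k => headCon T i (a : ℕ) (stripYT T) * hb0Con T j (a : ℕ) (b : ℕ) (stripYT T) * tailLen T k (b : ℕ) (stripYT T))
      (fun i j k => mul_nonneg (mul_nonneg (hc i j k).1.1 (hc i j k).2.1.1) (hG0 _)) (fun i j k => ?_) (fun i k => ?_),
    hconv (fun i j k => headCon T i (a : ℕ) (stripYT T) * hb0Len T j (a : ℕ) (b : ℕ) (stripYT T) * tailCon T k (b : ℕ) (stripYT T))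
      (fun i j k => mul_nonneg (mul_nonneg (hc i j k).1.1 (hD0 _)) (hc i j k).2.2.1.1) (fun i j k => ?_) (fun i k => ?_),
    hconv (fun i j k => headLen T i (a : ℕ) (stripYT T) * hb0Con T j (a : ℕ) (b : ℕ) (stripYT T) * tailCon T k (b : ℕ) (stripYT T))
      (fun i j k => mul_nonneg (mul_nonneg (hF0 _) (hc i j k).2.1.1) (hc i j k).2.2.1.1) (fun i j k => ?_) (fun i k => ?_)⟩
  -- (1) `c²f·d·g ≤ i² f K g ≤ (i+j+k)² f K g`; pointwise `≤ C` constant in `j`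
  · have h1 := (hc2 i j k).1.2
    have hn : (i : ℝ) ^ 2 ≤ ((i + j + k : ℕ) : ℝ) ^ 2 := by
      push_cast; nlinarith [(Nat.cast_nonneg i : (0:ℝ) ≤ i), (Nat.cast_nonneg j : (0:ℝ) ≤ j), (Nat.cast_nonneg k : (0:ℝ) ≤ k)]
    calc headCon2 T i (a : ℕ) (stripYT T) * hb0Len T j (a : ℕ) (b : ℕ) (stripYT T) * tailLen T k (b : ℕ) (stripYT T)
        ≤ ((i : ℝ) ^ 2 * headLen T i (a : ℕ) (stripYT T)) * K * tailLen T k (b : ℕ) (stripYT T) :=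
          mul_le_mul (mul_le_mul h1 (hK _ a b) (hD0 _) (mul_nonneg (sq_nonneg _) (hF0 _))) le_rfl (hG0 _)
            (mul_nonneg (mul_nonneg (sq_nonneg _) (hF0 _)) hK0)
      _ ≤ _ := by
          have h0 : 0 ≤ headLen T i (a : ℕ) (stripYT T) * K * tailLen T k (b : ℕ) (stripYT T) := mul_nonneg (mul_nonneg (hF0 _) hK0) (hG0 _)
          nlinarith
  · refine ⟨headCon2 T i (a : ℕ) (stripYT T) * K * tailLen T k (b : ℕ) (stripYT T), mul_nonneg (mul_nonneg (hc2 i 0 0).1.1 hK0) (hG0 _), fun j => ?_⟩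
    calc headCon2 T i (a : ℕ) (stripYT T) * hb0Len T j (a : ℕ) (b : ℕ) (stripYT T) * tailLen T k (b : ℕ) (stripYT T)
        ≤ headCon2 T i (a : ℕ) (stripYT T) * K * tailLen T k (b : ℕ) (stripYT T) :=
          mul_le_mul_of_nonneg_right (mul_le_mul_of_nonneg_left (hK _ a b) (hc2 i 0 0).1.1) (hG0 _)
      _ ≤ _ := by
          have h0 : 0 ≤ headCon2 T i (a : ℕ) (stripYT T) * K * tailLen T k (b : ℕ) (stripYT T) := mul_nonneg (mul_nonneg (hc2 i 0 0).1.1 hK0) (hG0 _)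
          have : (0 : ℝ) ≤ j := Nat.cast_nonneg _
          nlinarith
  -- (2) `f·d·c²g ≤ k² f K g`
  · have h1 := (hc2 i j k).2.2.1.2
    have hn : (k : ℝ) ^ 2 ≤ ((i + j + k : ℕ) : ℝ) ^ 2 := by
      push_cast; nlinarith [(Nat.cast_nonneg i : (0:ℝ) ≤ i), (Nat.cast_nonneg j : (0:ℝ) ≤ j), (Nat.cast_nonneg k : (0:ℝ) ≤ k)]
    calc headLen T i (a : ℕ) (stripYT T) * hb0Len T j (a : ℕ) (b : ℕ) (stripYT T) * tailCon2 T k (b : ℕ) (stripYT T)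
        ≤ headLen T i (a : ℕ) (stripYT T) * K * ((k : ℝ) ^ 2 * tailLen T k (b : ℕ) (stripYT T)) :=
          mul_le_mul (mul_le_mul_of_nonneg_left (hK _ a b) (hF0 _)) h1 (hc2 i j k).2.2.1.1 (mul_nonneg (hF0 _) hK0)
      _ ≤ _ := by
          have h0 : 0 ≤ headLen T i (a : ℕ) (stripYT T) * K * tailLen T k (b : ℕ) (stripYT T) := mul_nonneg (mul_nonneg (hF0 _) hK0) (hG0 _)
          nlinarith
  · refine ⟨headLen T i (a : ℕ) (stripYT T) * K * tailCon2 T k (b : ℕ) (stripYT T), mul_nonneg (mul_nonneg (hF0 _) hK0) (hc2 0 0 k).2.2.1.1, fun j => ?_⟩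
    calc headLen T i (a : ℕ) (stripYT T) * hb0Len T j (a : ℕ) (b : ℕ) (stripYT T) * tailCon2 T k (b : ℕ) (stripYT T)
        ≤ headLen T i (a : ℕ) (stripYT T) * K * tailCon2 T k (b : ℕ) (stripYT T) :=
          mul_le_mul_of_nonneg_right (mul_le_mul_of_nonneg_left (hK _ a b) (hF0 _)) (hc2 0 0 k).2.2.1.1
      _ ≤ _ := by
          have h0 : 0 ≤ headLen T i (a : ℕ) (stripYT T) * K * tailCon2 T k (b : ℕ) (stripYT T) := mul_nonneg (mul_nonneg (hF0 _) hK0) (hc2 0 0 k).2.2.1.1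
          have : (0 : ℝ) ≤ j := Nat.cast_nonneg _
          nlinarith
  -- (3) `cf·cd·g ≤ (i f)(j K) g ≤ (i+j+k)² f K g`; pointwise `≤ (cf·K·g)·(j+1)`
  · have h1 := (hc i j k).1.2
    have h2 := (hc i j k).2.1.2
    have hij : (i : ℝ) * j ≤ ((i + j + k : ℕ) : ℝ) ^ 2 := by
      push_cast; nlinarith [(Nat.cast_nonneg i : (0:ℝ) ≤ i), (Nat.cast_nonneg j : (0:ℝ) ≤ j), (Nat.cast_nonneg k : (0:ℝ) ≤ k)]
    calc headCon T i (a : ℕ) (stripYT T) * hb0Con T j (a : ℕ) (b : ℕ) (stripYT T) * tailLen T k (b : ℕ) (stripYT T)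
        ≤ ((i : ℝ) * headLen T i (a : ℕ) (stripYT T)) * ((j : ℝ) * K) * tailLen T k (b : ℕ) (stripYT T) :=
          mul_le_mul_of_nonneg_right (mul_le_mul h1 (h2.trans (mul_le_mul_of_nonneg_left (hK _ a b) (Nat.cast_nonneg _))) (hc i j k).2.1.1
            (mul_nonneg (Nat.cast_nonneg _) (hF0 _))) (hG0 _)
      _ = ((i : ℝ) * j) * (headLen T i (a : ℕ) (stripYT T) * K * tailLen T k (b : ℕ) (stripYT T)) := by ring
      _ ≤ _ := mul_le_mul_of_nonneg_right hij (mul_nonneg (mul_nonneg (hF0 _) hK0) (hG0 _))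
  · refine ⟨headCon T i (a : ℕ) (stripYT T) * K * tailLen T k (b : ℕ) (stripYT T), mul_nonneg (mul_nonneg (hc i 0 0).1.1 hK0) (hG0 _), fun j => ?_⟩
    have h2 := (hc i j k).2.1.2
    calc headCon T i (a : ℕ) (stripYT T) * hb0Con T j (a : ℕ) (b : ℕ) (stripYT T) * tailLen T k (b : ℕ) (stripYT T)
        ≤ headCon T i (a : ℕ) (stripYT T) * ((j : ℝ) * K) * tailLen T k (b : ℕ) (stripYT T) :=
          mul_le_mul_of_nonneg_right (mul_le_mul_of_nonneg_left (h2.trans (mul_le_mul_of_nonneg_left (hK _ a b) (Nat.cast_nonneg _))) (hc i 0 0).1.1) (hG0 _)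
      _ ≤ _ := by
          have h0 : 0 ≤ headCon T i (a : ℕ) (stripYT T) * K * tailLen T k (b : ℕ) (stripYT T) := mul_nonneg (mul_nonneg (hc i 0 0).1.1 hK0) (hG0 _)
          nlinarith
  -- (4) `cf·d·cg ≤ (i f) K (k g) ≤ (i+j+k)² f K g`; pointwise constant in `j`
  · have h1 := (hc i j k).1.2
    have h3 := (hc i j k).2.2.1.2
    have hik : (i : ℝ) * k ≤ ((i + j + k : ℕ) : ℝ) ^ 2 := by
      push_cast; nlinarith [(Nat.cast_nonneg i : (0:ℝ) ≤ i), (Nat.cast_nonneg j : (0:ℝ) ≤ j), (Nat.cast_nonneg k : (0:ℝ) ≤ k)]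
    calc headCon T i (a : ℕ) (stripYT T) * hb0Len T j (a : ℕ) (b : ℕ) (stripYT T) * tailCon T k (b : ℕ) (stripYT T)
        ≤ ((i : ℝ) * headLen T i (a : ℕ) (stripYT T)) * K * ((k : ℝ) * tailLen T k (b : ℕ) (stripYT T)) :=
          mul_le_mul (mul_le_mul h1 (hK _ a b) (hD0 _) (mul_nonneg (Nat.cast_nonneg _) (hF0 _))) h3 (hc i j k).2.2.1.1
            (mul_nonneg (mul_nonneg (Nat.cast_nonneg _) (hF0 _)) hK0)
      _ = ((i : ℝ) * k) * (headLen T i (a : ℕ) (stripYT T) * K * tailLen T k (b : ℕ) (stripYT T)) := by ring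
      _ ≤ _ := mul_le_mul_of_nonneg_right hik (mul_nonneg (mul_nonneg (hF0 _) hK0) (hG0 _))
  · refine ⟨headCon T i (a : ℕ) (stripYT T) * K * tailCon T k (b : ℕ) (stripYT T), mul_nonneg (mul_nonneg (hc i 0 0).1.1 hK0) (hc 0 0 k).2.2.1.1,
      fun j => ?_⟩
    calc headCon T i (a : ℕ) (stripYT T) * hb0Len T j (a : ℕ) (b : ℕ) (stripYT T) * tailCon T k (b : ℕ) (stripYT T)
        ≤ headCon T i (a : ℕ) (stripYT T) * K * tailCon T k (b : ℕ) (stripYT T) :=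
          mul_le_mul_of_nonneg_right (mul_le_mul_of_nonneg_left (hK _ a b) (hc i 0 0).1.1) (hc 0 0 k).2.2.1.1
      _ ≤ _ := by
          have h0 : 0 ≤ headCon T i (a : ℕ) (stripYT T) * K * tailCon T k (b : ℕ) (stripYT T) :=
            mul_nonneg (mul_nonneg (hc i 0 0).1.1 hK0) (hc 0 0 k).2.2.1.1
          have : (0 : ℝ) ≤ j := Nat.cast_nonneg _
          nlinarith
  -- (5) `f·cd·cg ≤ f (j K)(k g) ≤ (i+j+k)² f K g`; pointwise `≤ (f·K·cg)(j+1)`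
  · have h2 := (hc i j k).2.1.2
    have h3 := (hc i j k).2.2.1.2
    have hjk : (j : ℝ) * k ≤ ((i + j + k : ℕ) : ℝ) ^ 2 := by
      push_cast; nlinarith [(Nat.cast_nonneg i : (0:ℝ) ≤ i), (Nat.cast_nonneg j : (0:ℝ) ≤ j), (Nat.cast_nonneg k : (0:ℝ) ≤ k)]
    calc headLen T i (a : ℕ) (stripYT T) * hb0Con T j (a : ℕ) (b : ℕ) (stripYT T) * tailCon T k (b : ℕ) (stripYT T)
        ≤ headLen T i (a : ℕ) (stripYT T) * ((j : ℝ) * K) * ((k : ℝ) * tailLen T k (b : ℕ) (stripYT T)) :=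
          mul_le_mul (mul_le_mul_of_nonneg_left (h2.trans (mul_le_mul_of_nonneg_left (hK _ a b) (Nat.cast_nonneg _))) (hF0 _)) h3
            (hc i j k).2.2.1.1 (mul_nonneg (hF0 _) (mul_nonneg (Nat.cast_nonneg _) hK0))
      _ = ((j : ℝ) * k) * (headLen T i (a : ℕ) (stripYT T) * K * tailLen T k (b : ℕ) (stripYT T)) := by ring
      _ ≤ _ := mul_le_mul_of_nonneg_right hjk (mul_nonneg (mul_nonneg (hF0 _) hK0) (hG0 _))
  · refine ⟨headLen T i (a : ℕ) (stripYT T) * K * tailCon T k (b : ℕ) (stripYT T), mul_nonneg (mul_nonneg (hF0 _) hK0) (hc 0 0 k).2.2.1.1, fun j => ?_⟩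
    have h2 := (hc i j k).2.1.2
    calc headLen T i (a : ℕ) (stripYT T) * hb0Con T j (a : ℕ) (b : ℕ) (stripYT T) * tailCon T k (b : ℕ) (stripYT T)
        ≤ headLen T i (a : ℕ) (stripYT T) * ((j : ℝ) * K) * tailCon T k (b : ℕ) (stripYT T) :=
          mul_le_mul_of_nonneg_right (mul_le_mul_of_nonneg_left (h2.trans (mul_le_mul_of_nonneg_left (hK _ a b) (Nat.cast_nonneg _))) (hF0 _)) (hc 0 0 k).2.2.1.1
      _ ≤ _ := by
          have h0 : 0 ≤ headLen T i (a : ℕ) (stripYT T) * K * tailCon T k (b : ℕ) (stripYT T) := mul_nonneg (mul_nonneg (hF0 _) hK0) (hc 0 0 k).2.2.1.1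
          nlinarith

/-- ★★ **The middle squared-contact term, pointwise in the outer lengths** (`T ≥ 2`, conditional on `hC2`): for fixed `(i, k)` the parities force the
middle length `2m − i − k` onto the hat class `n_{k'} = 2k' + χ_a − χ_b`, `k' = m − c₀`, where «CONTACT-LLN» gives `Ĉ²_D(k')/(n_{k'}² D̂(k')) → θ_T²`,
#633 gives `D̂(k') → 2u_aℓ_b/⟨ℓ, M̄_len u⟩`, and `(n_{k'}/(2m))² → 1`:
`fℓ_a(i) · c²dℓ_{ab}(2m − i − k) · gℓ_b(k) / (2m)² → fℓ_a(i) · θ_T² · (2u_aℓ_b/⟨ℓ,M̄_len u⟩) · gℓ_b(k)`.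
[cite: Feller1968, XIII.6; DuminilCopinHammond2013, §2.2; lane «pcv-sawmu» a-p2 g24 — own] -/
theorem tendsto_midContactSqTerm_even (hT : 2 ≤ T) (hu0 : ∀ a, 0 < u a) (hℓ0 : ∀ b, 0 < ℓ b)
    (hu : Iinf T (stripYT T) *ᵥ u = u) (hℓ : ℓ ᵥ* Iinf T (stripYT T) = ℓ)
    (hC2 : ∀ a b : Fin (2 * T), Summable fun k : ℕ =>
      ∑ l ∈ LMset T (2 * k + 1) (hatLen k a b) (a : ℕ) (b : ℕ), (topCnt T l.tail : ℝ) ^ 2 * wD T (stripYT T) l)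
    (a b : Fin (2 * T)) (p : ℕ × ℕ) :
    Tendsto (fun m : ℕ => (if p.1 + p.2 ≤ 2 * m then
        headLen T p.1 (a : ℕ) (stripYT T) * hb0Con2 T (2 * m - p.1 - p.2) (a : ℕ) (b : ℕ) (stripYT T) * tailLen T p.2 (b : ℕ) (stripYT T)
        else 0) / (2 * (m : ℝ)) ^ 2) atTop
      (𝓝 (headLen T p.1 (a : ℕ) (stripYT T) *
        (((ℓ ⬝ᵥ ((Matrix.of fun c d : Fin (2 * T) =>
            ∑' n : ℕ, ∑ l ∈ LMset T n (n : ℤ) (c : ℕ) (d : ℕ), (topCnt T l.tail : ℝ) * wD T (stripYT T) l) *ᵥ u)) /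
          (ℓ ⬝ᵥ ((Matrix.of fun a b : Fin (2 * T) => ∑' n : ℕ, (n : ℝ) * LMM T n (n : ℤ) (stripYT T) a b) *ᵥ u))) ^ 2 *
          (2 * (u a * ℓ b / (ℓ ⬝ᵥ ((Matrix.of fun a b : Fin (2 * T) => ∑' n : ℕ, (n : ℝ) * LMM T n (n : ℤ) (stripYT T) a b) *ᵥ u))))) *
        tailLen T p.2 (b : ℕ) (stripYT T))) := by
  set θ : ℝ := (ℓ ⬝ᵥ ((Matrix.of fun c d : Fin (2 * T) =>
      ∑' n : ℕ, ∑ l ∈ LMset T n (n : ℤ) (c : ℕ) (d : ℕ), (topCnt T l.tail : ℝ) * wD T (stripYT T) l) *ᵥ u)) /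
    (ℓ ⬝ᵥ ((Matrix.of fun a b : Fin (2 * T) => ∑' n : ℕ, (n : ℝ) * LMM T n (n : ℤ) (stripYT T) a b) *ᵥ u)) with hθ
  set L2 : ℝ := 2 * (u a * ℓ b / (ℓ ⬝ᵥ ((Matrix.of fun a b : Fin (2 * T) => ∑' n : ℕ, (n : ℝ) * LMM T n (n : ℤ) (stripYT T) a b) *ᵥ u)))
    with hL2
  obtain ⟨i, k⟩ := p
  by_cases hFG : headLen T i (a : ℕ) (stripYT T) = 0 ∨ tailLen T k (b : ℕ) (stripYT T) = 0
  · have h0 : ∀ m : ℕ, (if i + k ≤ 2 * m then headLen T i (a : ℕ) (stripYT T) * hb0Con2 T (2 * m - i - k) (a : ℕ) (b : ℕ) (stripYT T) *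
        tailLen T k (b : ℕ) (stripYT T) else 0) / (2 * (m : ℝ)) ^ 2 = 0 := fun m => by
      split_ifs
      · rcases hFG with h | h <;> simp only [h, zero_mul, mul_zero, zero_div]
      · rw [zero_div]
    have hlim : headLen T i (a : ℕ) (stripYT T) * (θ ^ 2 * L2) * tailLen T k (b : ℕ) (stripYT T) = 0 := by
      rcases hFG with h | h <;> simp only [h, zero_mul, mul_zero]
    rw [hlim]
    simp only [h0]
    exact tendsto_const_nhds
  · obtain ⟨hF0, hG0⟩ := not_or.1 hFG
    have hpi := even_of_headLen_ne_zero hF0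
    have hpk := even_of_tailLen_ne_zero hG0
    obtain ⟨ha, hae⟩ := lchi_facts a
    obtain ⟨hb, hbe⟩ := lchi_facts b
    obtain ⟨r1, h1⟩ := hpi
    obtain ⟨r2, h2⟩ := hpk
    obtain ⟨r3, h3⟩ := hae
    obtain ⟨r4, h4⟩ := hbe
    obtain ⟨r, hr, hr0⟩ : ∃ r : ℤ, (i : ℤ) + k + lchi a - lchi b = 2 * r ∧ 0 ≤ r :=
      ⟨((a : ℕ) : ℤ) - ((b : ℕ) : ℤ) + (T : ℤ) - r1 - r2 - r3 + r4, by omega,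
        by rcases ha with ha | ha <;> rcases hb with hb | hb <;> omega⟩
    set c₀ : ℕ := r.toNat with hc₀
    have hc₀r : (c₀ : ℤ) = r := Int.toNat_of_nonneg hr0
    -- the squared-contact slice at hat index `m − c₀`
    set C2D : ℕ → ℝ := fun k' => ∑ l ∈ LUset T (2 * k' + 1) (hatLen k' a b) (a : ℕ) (b : ℕ),
      (topCnt T l.tail : ℝ) ^ 2 * wD T (stripYT T) l with hC2D
    have hEq : ∀ᶠ m : ℕ in atTop, (if i + k ≤ 2 * m then headLen T i (a : ℕ) (stripYT T) * hb0Con2 T (2 * m - i - k) (a : ℕ) (b : ℕ) (stripYT T) *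
        tailLen T k (b : ℕ) (stripYT T) else 0) / (2 * (m : ℝ)) ^ 2 =
        headLen T i (a : ℕ) (stripYT T) *
          (C2D (m - c₀) / ((hatLen (m - c₀) a b : ℝ) ^ 2 * hatD T (stripYT T) (m - c₀) a b) * hatD T (stripYT T) (m - c₀) a b *
            ((hatLen (m - c₀) a b : ℝ) / (2 * (m : ℝ))) ^ 2) * tailLen T k (b : ℕ) (stripYT T) := by
      filter_upwards [eventually_ge_atTop (c₀ + 1)] with m hm
      have hj : 1 ≤ 2 * m - i - k := by rcases ha with ha | ha <;> rcases hb with hb | hb <;> omega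
      rw [if_pos (by omega)]
      have hσ : hatLen (m - c₀) a b = ((2 * m - i - k : ℕ) : ℤ) := by
        unfold hatLen
        rcases ha with ha | ha <;> rcases hb with hb | hb <;> omega
      have hN : ((2 * m - i - k : ℕ) : ℤ) ≤ ((2 * (m - c₀) + 1 : ℕ) : ℤ) := by
        rcases ha with ha | ha <;> rcases hb with hb | hb <;> omega
      have hslice : hb0Con2 T (2 * m - i - k) (a : ℕ) (b : ℕ) (stripYT T) = C2D (m - c₀) := by
        rw [hb0Con2_eq_sum_LUset hj, hC2D]
        simp only
        rw [hσ, LUset_eq_of_le (show ((2 * m - i - k : ℕ) : ℤ) ≤ ((2 * m - i - k : ℕ) : ℤ) from le_rfl) hN]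
      have hn0 : (hatLen (m - c₀) a b : ℝ) ≠ 0 := by rw [hσ]; push_cast; exact_mod_cast (show (2 * m - i - k : ℕ) ≠ 0 by omega)
      have hm0 : (2 * (m : ℝ)) ≠ 0 := by exact_mod_cast (show (2 * m : ℕ) ≠ 0 by omega)
      rw [hslice]
      by_cases hD : hatD T (stripYT T) (m - c₀) a b = 0
      · have hC0 : C2D (m - c₀) = 0 := by
          have hf := (hat_contactSqSlices_facts hT (m - c₀) a b).1
          rw [hD, mul_zero] at hf
          exact le_antisymm hf.2 hf.1
        rw [hC0, hD]
        simp
      · field_simp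
    -- limits of the three factors
    have hlim1 : Tendsto (fun m : ℕ => C2D (m - c₀) / ((hatLen (m - c₀) a b : ℝ) ^ 2 * hatD T (stripYT T) (m - c₀) a b)) atTop
        (𝓝 (θ ^ 2)) :=
      (tendsto_contactSq_per_step_sq hT hu0 hℓ0 hu hℓ hC2 a b).comp (tendsto_sub_atTop_nat c₀)
    have hlim2 : Tendsto (fun m : ℕ => hatD T (stripYT T) (m - c₀) a b) atTop (𝓝 L2) :=
      ((bridge_amplitudes_explicit hT hu0 hℓ0 hu hℓ a b).2).comp (tendsto_sub_atTop_nat c₀)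
    have hlim3 : Tendsto (fun m : ℕ => ((hatLen (m - c₀) a b : ℝ) / (2 * (m : ℝ))) ^ 2) atTop (𝓝 1) := by
      have hform : ∀ᶠ m : ℕ in atTop, (hatLen (m - c₀) a b : ℝ) / (2 * (m : ℝ)) = 1 - ((i : ℝ) + k) / (2 * (m : ℝ)) := by
        filter_upwards [eventually_ge_atTop (c₀ + 1)] with m hm
        have hσ : (hatLen (m - c₀) a b : ℝ) = 2 * (m : ℝ) - ((i : ℝ) + k) := by
          have : hatLen (m - c₀) a b = 2 * (m : ℤ) - (i + k) := by
            unfold hatLen; rcases ha with ha | ha <;> rcases hb with hb | hb <;> omega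
          rw [this]; push_cast; ring
        have hm0 : (2 * (m : ℝ)) ≠ 0 := by exact_mod_cast (show (2 * m : ℕ) ≠ 0 by omega)
        rw [hσ, sub_div, div_self hm0]
      have hl : Tendsto (fun m : ℕ => 1 - ((i : ℝ) + k) / (2 * (m : ℝ))) atTop (𝓝 (1 - 0)) :=
        tendsto_const_nhds.sub (tendsto_const_nhds.div_atTop (Tendsto.const_mul_atTop two_pos tendsto_natCast_atTop_atTop))
      rw [sub_zero] at hl
      have h1 := (hl.congr' (hform.mono fun m hm => hm.symm)).pow 2
      rwa [one_pow] at h1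
    have hprod := ((hlim1.mul hlim2).mul hlim3)
    rw [mul_one] at hprod
    have hfull := (hprod.const_mul (headLen T i (a : ℕ) (stripYT T))).mul_const (tailLen T k (b : ℕ) (stripYT T))
    refine hfull.congr' (hEq.mono fun m hm => ?_)
    beta_reduce
    exact hm.symm

set_option maxHeartbeats 400000 in -- Tannery with two heavy summability side conditions (as «BETA-CONTACT-DENSITY»; LANE NOTICE #11)
/-- ★★ **The middle squared-contact term converges along even lengths** (`T ≥ 2`, conditional on `hC2`):
`(1/(2m)²) Σ_{i+j+k=2m} fℓ_a(i) c²dℓ_{ab}(j) gℓ_b(k) → Fℓ_a · θ_T² · (2u_aℓ_b/⟨ℓ,M̄_len u⟩) · Gℓ_b` — Tannery over `(i,k) ∈ ℕ²`, dominated by `fℓ_a(i)·K·gℓ_b(k)`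
(`c²dℓ(j) ≤ j²·dℓ(j) ≤ (2m)²·K`). [cite: Feller1968, XIII.6; DuminilCopinHammond2013, §2.2; lane «pcv-sawmu» a-p2 g24 — own] -/
theorem tendsto_midContactSqSum_div_sq (hT : 2 ≤ T) (hu0 : ∀ a, 0 < u a) (hℓ0 : ∀ b, 0 < ℓ b)
    (hu : Iinf T (stripYT T) *ᵥ u = u) (hℓ : ℓ ᵥ* Iinf T (stripYT T) = ℓ)
    (hC2 : ∀ a b : Fin (2 * T), Summable fun k : ℕ =>
      ∑ l ∈ LMset T (2 * k + 1) (hatLen k a b) (a : ℕ) (b : ℕ), (topCnt T l.tail : ℝ) ^ 2 * wD T (stripYT T) l)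
    (a b : Fin (2 * T)) :
    Tendsto (fun m : ℕ => (∑ t ∈ T3 (2 * m), headLen T t.1 (a : ℕ) (stripYT T) * hb0Con2 T t.2.1 (a : ℕ) (b : ℕ) (stripYT T) *
        tailLen T t.2.2 (b : ℕ) (stripYT T)) / (2 * (m : ℝ)) ^ 2) atTop
      (𝓝 (headLenGF T (a : ℕ) *
        (((ℓ ⬝ᵥ ((Matrix.of fun c d : Fin (2 * T) =>
            ∑' n : ℕ, ∑ l ∈ LMset T n (n : ℤ) (c : ℕ) (d : ℕ), (topCnt T l.tail : ℝ) * wD T (stripYT T) l) *ᵥ u)) /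
          (ℓ ⬝ᵥ ((Matrix.of fun a b : Fin (2 * T) => ∑' n : ℕ, (n : ℝ) * LMM T n (n : ℤ) (stripYT T) a b) *ᵥ u))) ^ 2 *
          (2 * (u a * ℓ b / (ℓ ⬝ᵥ ((Matrix.of fun a b : Fin (2 * T) => ∑' n : ℕ, (n : ℝ) * LMM T n (n : ℤ) (stripYT T) a b) *ᵥ u))))) *
        tailLenGF T (b : ℕ))) := by
  set Lc : ℝ := ((ℓ ⬝ᵥ ((Matrix.of fun c d : Fin (2 * T) =>
            ∑' n : ℕ, ∑ l ∈ LMset T n (n : ℤ) (c : ℕ) (d : ℕ), (topCnt T l.tail : ℝ) * wD T (stripYT T) l) *ᵥ u)) /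
          (ℓ ⬝ᵥ ((Matrix.of fun a b : Fin (2 * T) => ∑' n : ℕ, (n : ℝ) * LMM T n (n : ℤ) (stripYT T) a b) *ᵥ u))) ^ 2 *
    (2 * (u a * ℓ b / (ℓ ⬝ᵥ ((Matrix.of fun a b : Fin (2 * T) => ∑' n : ℕ, (n : ℝ) * LMM T n (n : ℤ) (stripYT T) a b) *ᵥ u)))) with hLc
  have hT1 : 1 ≤ T := by omega
  have hy : 0 ≤ stripYT T := (stripYT_pos hT1).le
  obtain ⟨K, hK⟩ := exists_hb0Len_stripYT_le hT1
  have hK0 : 0 ≤ K := le_trans (pieceLen_nonneg hy 0 ((a : ℕ) : ℤ) ((b : ℕ) : ℤ)).2.1 (hK 0 a b)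
  have hsF := summable_headLen hT ((a : ℕ) : ℤ)
  have hsG := summable_tailLen hT ((b : ℕ) : ℤ)
  have hF0 : ∀ i, 0 ≤ headLen T i (a : ℕ) (stripYT T) := fun i => (pieceLen_nonneg hy i ((a : ℕ) : ℤ) ((b : ℕ) : ℤ)).1
  have hG0 : ∀ k, 0 ≤ tailLen T k (b : ℕ) (stripYT T) := fun k => (pieceLen_nonneg hy k ((a : ℕ) : ℤ) ((b : ℕ) : ℤ)).2.2
  have hbound : Summable (fun p : ℕ × ℕ => headLen T p.1 (a : ℕ) (stripYT T) * K * tailLen T p.2 (b : ℕ) (stripYT T)) :=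
    Summable.mul_of_nonneg (f := fun i => headLen T i (a : ℕ) (stripYT T) * K) (g := fun k => tailLen T k (b : ℕ) (stripYT T))
      (hsF.mul_right K) hsG (fun i => mul_nonneg (hF0 i) hK0) hG0
  have hbase : Summable (fun p : ℕ × ℕ => headLen T p.1 (a : ℕ) (stripYT T) * tailLen T p.2 (b : ℕ) (stripYT T)) :=
    Summable.mul_of_nonneg (f := fun i => headLen T i (a : ℕ) (stripYT T)) (g := fun k => tailLen T k (b : ℕ) (stripYT T)) hsF hsG hF0 hG0
  have hprod : Summable (fun p : ℕ × ℕ => headLen T p.1 (a : ℕ) (stripYT T) * Lc * tailLen T p.2 (b : ℕ) (stripYT T)) := by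
    have h := hbase.mul_left Lc
    refine h.congr fun p => ?_
    ring
  set Φ : ℕ → ℕ × ℕ → ℝ := fun m p => (if p.1 + p.2 ≤ 2 * m then
      headLen T p.1 (a : ℕ) (stripYT T) * hb0Con2 T (2 * m - p.1 - p.2) (a : ℕ) (b : ℕ) (stripYT T) * tailLen T p.2 (b : ℕ) (stripYT T)
      else 0) / (2 * (m : ℝ)) ^ 2 with hΦ
  have hdom : ∀ᶠ m in atTop, ∀ p : ℕ × ℕ, ‖Φ m p‖ ≤ headLen T p.1 (a : ℕ) (stripYT T) * K * tailLen T p.2 (b : ℕ) (stripYT T) := by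
    filter_upwards [eventually_ge_atTop 1] with m hm p
    rw [Real.norm_eq_abs, hΦ]
    simp only
    have hc := (con2_le (T := T) hy 0 (2 * m - p.1 - p.2) 0 0 ((a : ℕ) : ℤ) ((b : ℕ) : ℤ)).2.1
    have hm0 : (0 : ℝ) < (2 * (m : ℝ)) ^ 2 := by
      have h2m : (0 : ℝ) < 2 * (m : ℝ) := by exact_mod_cast (show 0 < 2 * m by omega)
      exact pow_pos h2m 2
    split_ifs with h
    · rw [abs_div, abs_of_nonneg (mul_nonneg (mul_nonneg (hF0 _) hc.1) (hG0 _)), abs_of_pos hm0, div_le_iff₀ hm0]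
      have hj : ((2 * m - p.1 - p.2 : ℕ) : ℝ) ^ 2 ≤ (2 * (m : ℝ)) ^ 2 := by
        have : ((2 * m - p.1 - p.2 : ℕ) : ℝ) ≤ 2 * (m : ℝ) := by exact_mod_cast (show 2 * m - p.1 - p.2 ≤ 2 * m by omega)
        exact pow_le_pow_left₀ (Nat.cast_nonneg _) this 2
      calc headLen T p.1 (a : ℕ) (stripYT T) * hb0Con2 T (2 * m - p.1 - p.2) (a : ℕ) (b : ℕ) (stripYT T) * tailLen T p.2 (b : ℕ) (stripYT T)
          ≤ headLen T p.1 (a : ℕ) (stripYT T) * (((2 * m - p.1 - p.2 : ℕ) : ℝ) ^ 2 * K) * tailLen T p.2 (b : ℕ) (stripYT T) :=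
            mul_le_mul_of_nonneg_right (mul_le_mul_of_nonneg_left (hc.2.trans (mul_le_mul_of_nonneg_left (hK _ a b) (sq_nonneg _)))
              (hF0 _)) (hG0 _)
        _ ≤ headLen T p.1 (a : ℕ) (stripYT T) * K * tailLen T p.2 (b : ℕ) (stripYT T) * (2 * (m : ℝ)) ^ 2 := by
            have h1 : 0 ≤ headLen T p.1 (a : ℕ) (stripYT T) * K * tailLen T p.2 (b : ℕ) (stripYT T) :=
              mul_nonneg (mul_nonneg (hF0 _) hK0) (hG0 _)
            nlinarith
    · rw [zero_div, abs_zero]; exact mul_nonneg (mul_nonneg (hF0 _) hK0) (hG0 _)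
  have hlim : Tendsto (fun m : ℕ => ∑' p : ℕ × ℕ, Φ m p) atTop
      (𝓝 (∑' p : ℕ × ℕ, headLen T p.1 (a : ℕ) (stripYT T) * Lc * tailLen T p.2 (b : ℕ) (stripYT T))) :=
    tendsto_tsum_of_dominated_convergence (𝓕 := atTop) (f := Φ)
      (g := fun p : ℕ × ℕ => headLen T p.1 (a : ℕ) (stripYT T) * Lc * tailLen T p.2 (b : ℕ) (stripYT T))
      (bound := fun p : ℕ × ℕ => headLen T p.1 (a : ℕ) (stripYT T) * K * tailLen T p.2 (b : ℕ) (stripYT T))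
      hbound (fun p => by have := tendsto_midContactSqTerm_even hT hu0 hℓ0 hu hℓ hC2 a b p; rwa [← hLc] at this) hdom
  have hg : ∑' p : ℕ × ℕ, headLen T p.1 (a : ℕ) (stripYT T) * Lc * tailLen T p.2 (b : ℕ) (stripYT T) =
      headLenGF T (a : ℕ) * Lc * tailLenGF T (b : ℕ) := by
    rw [headLenGF, tailLenGF, ← tsum_mul_right]
    exact ((hsF.mul_right _).tsum_mul_tsum hsG hprod).symm
  rw [← hg]
  refine hlim.congr fun m => ?_
  rw [hΦ]
  simp only
  have h3 := sum_T3_eq_tsum m (fun i j k => headLen T i (a : ℕ) (stripYT T) * hb0Con2 T j (a : ℕ) (b : ℕ) (stripYT T) *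
    tailLen T k (b : ℕ) (stripYT T))
  beta_reduce at h3
  rw [h3, ← tsum_div_const]

end Tannery

/-! ### §5 ★★★★ The second moment, the variance and the weak law for the contacts of long critical β-walks -/

section Law

variable {u ℓ : Fin (2 * T) → ℝ}

/-- ★★★ **THE NORMALISED SECOND CONTACT MOMENT OF LONG CRITICAL β-WALKS** (`T ≥ 2`, conditional on the finite second contact moment `hC2` of the
critical irreducible kernel — true at `T = 2`): with `c²β_T(n) = Σ_{β-walks ω with n vertices} #top(ω)² x_c^{n} y_T^{#top(ω)}` and `bℓ_T(n)` the plain sum,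
`c²β_T(2m) / ((2m)² · bℓ_T(2m)) ⟶ θ_T²` (`θ_T = ⟨ℓ, C̄_M u⟩/⟨ℓ, M̄_len u⟩`, `u`, `ℓ` any positive fixed vectors of `Iinf T y_T`): of the six terms of
`betaCon2_eq_two_mul` only `fℓ·c²dℓ·gℓ` survives the division by `(2m)²`. [cite: Feller1968, XIII.6; DuminilCopinHammond2013, §2.2; BeatonBousquetMelouDeGierDuminilCopinGuttmann2014, Cor. 8; lane «pcv-sawmu» a-p2 g24 — own result] -/
theorem tendsto_betaCon2_div_sq (hT : 2 ≤ T) (hu0 : ∀ a, 0 < u a) (hℓ0 : ∀ b, 0 < ℓ b)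
    (hu : Iinf T (stripYT T) *ᵥ u = u) (hℓ : ℓ ᵥ* Iinf T (stripYT T) = ℓ)
    (hC2 : ∀ a b : Fin (2 * T), Summable fun k : ℕ =>
      ∑ l ∈ LMset T (2 * k + 1) (hatLen k a b) (a : ℕ) (b : ℕ), (topCnt T l.tail : ℝ) ^ 2 * wD T (stripYT T) l) :
    Tendsto (fun m : ℕ => betaCon2 T (2 * m) (stripYT T) / ((2 * (m : ℝ)) ^ 2 * betaLenSum T (2 * m) (stripYT T))) atTop
      (𝓝 (((ℓ ⬝ᵥ ((Matrix.of fun c d : Fin (2 * T) =>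
            ∑' n : ℕ, ∑ l ∈ LMset T n (n : ℤ) (c : ℕ) (d : ℕ), (topCnt T l.tail : ℝ) * wD T (stripYT T) l) *ᵥ u)) /
          (ℓ ⬝ᵥ ((Matrix.of fun a b : Fin (2 * T) => ∑' n : ℕ, (n : ℝ) * LMM T n (n : ℤ) (stripYT T) a b) *ᵥ u))) ^ 2)) := by
  have hT1 : 1 ≤ T := by omega
  have hyT : 0 < stripYT T := stripYT_pos hT1
  set θ : ℝ := (ℓ ⬝ᵥ ((Matrix.of fun c d : Fin (2 * T) =>
      ∑' n : ℕ, ∑ l ∈ LMset T n (n : ℤ) (c : ℕ) (d : ℕ), (topCnt T l.tail : ℝ) * wD T (stripYT T) l) *ᵥ u)) /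
    (ℓ ⬝ᵥ ((Matrix.of fun a b : Fin (2 * T) => ∑' n : ℕ, (n : ℝ) * LMM T n (n : ℤ) (stripYT T) a b) *ᵥ u)) with hθ
  set dl : ℝ := ℓ ⬝ᵥ ((Matrix.of fun a b : Fin (2 * T) => ∑' n : ℕ, (n : ℝ) * LMM T n (n : ℤ) (stripYT T) a b) *ᵥ u) with hdl
  obtain ⟨hl, -⟩ := tendsto_stripLenD_residue_explicit hT hu0 hℓ0 hu hℓ
  rw [← hdl] at hl
  have hlaw : ∀ a b : Fin (2 * T), Tendsto (fun k : ℕ => LUM T (2 * k + 1) (2 * (k : ℤ) + lchi a - lchi b) (stripYT T) a b) atTop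
      (𝓝 (2 * ((1 / dl) * (u a * ℓ b)))) := fun a b => by
    have := (bridge_amplitudes_explicit hT hu0 hℓ0 hu hℓ a b).2
    rwa [← hdl, show u a * ℓ b / dl = 1 / dl * (u a * ℓ b) by ring] at this
  set Λ : ℝ := 2 * (0 + ∑ a : Fin (2 * T), ∑ b : Fin (2 * T), headLenGF T (a : ℕ) * (2 * ((1 / dl) * (u a * ℓ b))) * tailLenGF T (b : ℕ))
    with hΛ
  have hB : Tendsto (fun m : ℕ => betaLenSum T (2 * m) (stripYT T)) atTop (𝓝 Λ) := by
    have h := ((tendsto_noRenLen_atTop hT).comp (tendsto_id.const_mul_atTop' two_pos)).add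
      (tendsto_betaRenewalLen_even hT hu0 hℓ0 (one_div_pos.2 hl) hlaw)
    have h2 := h.const_mul 2
    refine h2.congr fun m => ?_
    rw [betaLenSum_eq_two_mul hT1 hyT.le]
    rfl
  have hΛpos : 0 < Λ := by
    obtain ⟨Λ', hΛ', hlim', -⟩ := exists_pos_tendsto_betaLenSum_even hT
    rwa [tendsto_nhds_unique hB hlim']
  -- `c²β(2m)/(2m)² → 2·Σ_{a,b} Fℓ_a θ² (2u_aℓ_b/dl) Gℓ_b = θ²·Λ`
  have hC : Tendsto (fun m : ℕ => betaCon2 T (2 * m) (stripYT T) / (2 * (m : ℝ)) ^ 2) atTop (𝓝 (θ ^ 2 * Λ)) := by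
    have hN : Tendsto (fun m : ℕ => noRenCon2 T (2 * m) (stripYT T) / (2 * (m : ℝ)) ^ 2) atTop (𝓝 0) := by
      have hup := (tendsto_noRenLen_atTop hT).comp (tendsto_id.const_mul_atTop' two_pos)
      refine squeeze_zero' ?_ ?_ hup
      · filter_upwards with m
        exact div_nonneg (con2_le hyT.le 0 0 0 (2 * m) 0 0).2.2.2.1 (by positivity)
      · filter_upwards [eventually_ge_atTop 1] with m hm
        have hm0 : (0 : ℝ) < (2 * (m : ℝ)) ^ 2 := by
          have h2m : (0 : ℝ) < 2 * (m : ℝ) := by exact_mod_cast (show 0 < 2 * m by omega)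
          exact pow_pos h2m 2
        rw [div_le_iff₀ hm0]
        have := (con2_le (T := T) hyT.le 0 0 0 (2 * m) 0 0).2.2.2.2
        simp only [Function.comp, id]
        calc noRenCon2 T (2 * m) (stripYT T) ≤ ((2 * m : ℕ) : ℝ) ^ 2 * noRenLen T (2 * m) (stripYT T) := this
          _ = noRenLen T (2 * m) (stripYT T) * (2 * (m : ℝ)) ^ 2 := by push_cast; ring
    have hS : ∀ a b : Fin (2 * T), Tendsto (fun m : ℕ => (∑ t ∈ T3 (2 * m),
        (headCon2 T t.1 (a : ℕ) (stripYT T) * hb0Len T t.2.1 (a : ℕ) (b : ℕ) (stripYT T) * tailLen T t.2.2 (b : ℕ) (stripYT T) +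
          headLen T t.1 (a : ℕ) (stripYT T) * hb0Con2 T t.2.1 (a : ℕ) (b : ℕ) (stripYT T) * tailLen T t.2.2 (b : ℕ) (stripYT T) +
          headLen T t.1 (a : ℕ) (stripYT T) * hb0Len T t.2.1 (a : ℕ) (b : ℕ) (stripYT T) * tailCon2 T t.2.2 (b : ℕ) (stripYT T) +
          2 * (headCon T t.1 (a : ℕ) (stripYT T) * hb0Con T t.2.1 (a : ℕ) (b : ℕ) (stripYT T) * tailLen T t.2.2 (b : ℕ) (stripYT T) +
            headCon T t.1 (a : ℕ) (stripYT T) * hb0Len T t.2.1 (a : ℕ) (b : ℕ) (stripYT T) * tailCon T t.2.2 (b : ℕ) (stripYT T) +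
            headLen T t.1 (a : ℕ) (stripYT T) * hb0Con T t.2.1 (a : ℕ) (b : ℕ) (stripYT T) * tailCon T t.2.2 (b : ℕ) (stripYT T)))) /
        (2 * (m : ℝ)) ^ 2) atTop
        (𝓝 (0 + headLenGF T (a : ℕ) * (θ ^ 2 * (2 * (u a * ℓ b / dl))) * tailLenGF T (b : ℕ) + 0 + 2 * (0 + 0 + 0))) := fun a b => by
      obtain ⟨h1, h3, h4, h5, h6⟩ := tendsto_endContactSqTerms_div_sq hT a b
      have h2 := tendsto_midContactSqSum_div_sq hT hu0 hℓ0 hu hℓ hC2 a b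
      rw [← hθ, ← hdl] at h2
      have h := ((h1.add h2).add h3).add (((h4.add h5).add h6).const_mul 2)
      refine h.congr fun m => ?_
      simp only [sum_add_distrib, ← mul_sum, add_div]
      ring
    have hsum := tendsto_finsetSum (Finset.univ : Finset (Fin (2 * T))) fun a _ =>
      tendsto_finsetSum (Finset.univ : Finset (Fin (2 * T))) fun b _ => hS a b
    have htot := (hN.add hsum).const_mul 2
    have hval : 2 * (0 + ∑ a : Fin (2 * T), ∑ b : Fin (2 * T),
        (0 + headLenGF T (a : ℕ) * (θ ^ 2 * (2 * (u a * ℓ b / dl))) * tailLenGF T (b : ℕ) + 0 + 2 * (0 + 0 + 0))) = θ ^ 2 * Λ := by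
      rw [hΛ]
      simp only [zero_add, add_zero, mul_zero]
      rw [mul_sum, mul_sum, mul_sum]
      refine sum_congr rfl fun a _ => ?_
      rw [mul_sum, mul_sum, mul_sum]
      refine sum_congr rfl fun b _ => ?_
      ring
    rw [hval] at htot
    refine htot.congr' ?_
    filter_upwards [eventually_ge_atTop 1] with m hm
    rw [betaCon2_eq_two_mul hT1 hyT (2 * m), mul_div_assoc, add_div, Finset.sum_div]
    congr 2
    refine sum_congr rfl fun a _ => ?_
    rw [Finset.sum_div]
  have hq := hC.div hB hΛpos.ne'
  rw [mul_div_cancel_right₀ _ hΛpos.ne'] at hq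
  refine hq.congr fun m => ?_
  simp only [Pi.div_apply]
  rw [div_div]

/-- ★★★★ **THE VARIANCE OF THE CONTACT DENSITY OF LONG CRITICAL β-WALKS VANISHES** (`T ≥ 2`, conditional on `hC2`):
`Σ_{β-walks ω with 2m vertices} (#top(ω) − θ_T·2m)² x_c^{2m} y_T^{#top(ω)} / ((2m)² · bℓ_T(2m)) ⟶ 0` — from `c²β/((2m)²bℓ) → θ_T²`
(`tendsto_betaCon2_div_sq`), `cβ/(2m·bℓ) → θ_T` («BETA-CONTACT-DENSITY») and `bℓ(2m) → Λℓ > 0` («BETA-LENGTH-LAW»).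
[cite: Feller1968, XIII.6 (variance of the number of renewals); DuminilCopinHammond2013, §2.2; lane «pcv-sawmu» a-p2 g24 — own result] -/
theorem tendsto_beta_contacts_variance (hT : 2 ≤ T) (hu0 : ∀ a, 0 < u a) (hℓ0 : ∀ b, 0 < ℓ b)
    (hu : Iinf T (stripYT T) *ᵥ u = u) (hℓ : ℓ ᵥ* Iinf T (stripYT T) = ℓ)
    (hC2 : ∀ a b : Fin (2 * T), Summable fun k : ℕ =>
      ∑ l ∈ LMset T (2 * k + 1) (hatLen k a b) (a : ℕ) (b : ℕ), (topCnt T l.tail : ℝ) ^ 2 * wD T (stripYT T) l) :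
    Tendsto (fun m : ℕ => (∑ l ∈ betaLen T (2 * m) (2 * m),
        ((topCnt T l : ℝ) - (ℓ ⬝ᵥ ((Matrix.of fun c d : Fin (2 * T) =>
              ∑' n : ℕ, ∑ l ∈ LMset T n (n : ℤ) (c : ℕ) (d : ℕ), (topCnt T l.tail : ℝ) * wD T (stripYT T) l) *ᵥ u)) /
            (ℓ ⬝ᵥ ((Matrix.of fun a b : Fin (2 * T) => ∑' n : ℕ, (n : ℝ) * LMM T n (n : ℤ) (stripYT T) a b) *ᵥ u)) * (2 * (m : ℝ))) ^ 2 *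
          (hexCriticalFugacity ^ l.length * stripYT T ^ topCnt T l)) / ((2 * (m : ℝ)) ^ 2 * betaLenSum T (2 * m) (stripYT T))) atTop (𝓝 0) := by
  set θ : ℝ := (ℓ ⬝ᵥ ((Matrix.of fun c d : Fin (2 * T) =>
      ∑' n : ℕ, ∑ l ∈ LMset T n (n : ℤ) (c : ℕ) (d : ℕ), (topCnt T l.tail : ℝ) * wD T (stripYT T) l) *ᵥ u)) /
    (ℓ ⬝ᵥ ((Matrix.of fun a b : Fin (2 * T) => ∑' n : ℕ, (n : ℝ) * LMM T n (n : ℤ) (stripYT T) a b) *ᵥ u)) with hθ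
  have hQ := tendsto_betaCon2_div_sq hT hu0 hℓ0 hu hℓ hC2
  have hP := tendsto_beta_contacts_per_step hT hu0 hℓ0 hu hℓ
  rw [← hθ] at hQ hP
  have hlim : Tendsto (fun m : ℕ => betaCon2 T (2 * m) (stripYT T) / ((2 * (m : ℝ)) ^ 2 * betaLenSum T (2 * m) (stripYT T)) -
      2 * θ * (betaCon T (2 * m) (stripYT T) / ((2 * (m : ℝ)) * betaLenSum T (2 * m) (stripYT T))) + θ ^ 2) atTop
      (𝓝 (θ ^ 2 - 2 * θ * θ + θ ^ 2)) :=
    (hQ.sub (hP.const_mul (2 * θ))).add tendsto_const_nhds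
  have hzero : θ ^ 2 - 2 * θ * θ + θ ^ 2 = 0 := by ring
  rw [hzero] at hlim
  obtain ⟨Λ, hΛ, hB, -⟩ := exists_pos_tendsto_betaLenSum_even hT
  have hBpos : ∀ᶠ m : ℕ in atTop, 0 < betaLenSum T (2 * m) (stripYT T) := hB.eventually (eventually_gt_nhds hΛ)
  refine hlim.congr' ?_
  filter_upwards [eventually_ge_atTop 1, hBpos] with m hm hBm
  have hm0 : (2 * (m : ℝ)) ≠ 0 := by exact_mod_cast (show (2 * m : ℕ) ≠ 0 by omega)
  have hB0 : betaLenSum T (2 * m) (stripYT T) ≠ 0 := hBm.ne'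
  set S := betaLen T (2 * m) (2 * m) with hS
  set w := fun l : List HV => hexCriticalFugacity ^ l.length * stripYT T ^ topCnt T l with hw
  have hsum : ∑ l ∈ S, ((topCnt T l : ℝ) - θ * (2 * (m : ℝ))) ^ 2 * w l =
      ∑ l ∈ S, (topCnt T l : ℝ) ^ 2 * w l - 2 * θ * (2 * (m : ℝ)) * ∑ l ∈ S, (topCnt T l : ℝ) * w l +
        θ ^ 2 * (2 * (m : ℝ)) ^ 2 * ∑ l ∈ S, w l := by
    rw [mul_sum, mul_sum, ← sum_sub_distrib, ← sum_add_distrib]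
    exact sum_congr rfl fun l _ => by ring
  have h2 : betaCon2 T (2 * m) (stripYT T) = ∑ l ∈ S, (topCnt T l : ℝ) ^ 2 * w l := by rw [betaCon2]
  have h1 : betaCon T (2 * m) (stripYT T) = ∑ l ∈ S, (topCnt T l : ℝ) * w l := by rw [betaCon]
  have h0 : betaLenSum T (2 * m) (stripYT T) = ∑ l ∈ S, w l := by rw [betaLenSum]
  rw [hsum, ← h2, ← h1, ← h0]
  field_simp

set_option maxHeartbeats 400000 in -- headroom (lit-1 g29 probe 08:38Z: 140–180k of the 200k default; LANE NOTICE #11)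
/-- ★★★★ **WEAK LAW FOR THE SURFACE CONTACTS OF A LONG CRITICAL β-WALK** (`T ≥ 2`; conditional on the finite second contact moment `hC2` of the
critical irreducible kernel; Chebyshev).  For every `ε > 0`, with `θ_T = ⟨ℓ, C̄_M u⟩/⟨ℓ, M̄_len u⟩` the bridge contact density of #687:
`(Σ_{β-walks ω of S_T with 2m vertices and |#top(ω)/(2m) − θ_T| ≥ ε} x_c^{2m} y_T^{#top(ω)}) / bℓ_T(2m) ⟶ 0`
— under the critical weights, the fraction (by weight) of β-walks whose surface-contact density deviates from `θ_T` vanishes.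
[cite: Feller1968, XIII.6 (variance; Chebyshev); DuminilCopinHammond2013, §2.2; BeatonBousquetMelouDeGierDuminilCopinGuttmann2014, Cor. 8 (the strip at (x_c, y_T)); lane «pcv-sawmu» a-p2 g24 — own result, not in print] -/
theorem tendsto_beta_contacts_deviation (hT : 2 ≤ T) (hu0 : ∀ a, 0 < u a) (hℓ0 : ∀ b, 0 < ℓ b)
    (hu : Iinf T (stripYT T) *ᵥ u = u) (hℓ : ℓ ᵥ* Iinf T (stripYT T) = ℓ)
    (hC2 : ∀ a b : Fin (2 * T), Summable fun k : ℕ =>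
      ∑ l ∈ LMset T (2 * k + 1) (hatLen k a b) (a : ℕ) (b : ℕ), (topCnt T l.tail : ℝ) ^ 2 * wD T (stripYT T) l) {ε : ℝ} (hε : 0 < ε) :
    Tendsto (fun m : ℕ => (∑ l ∈ (betaLen T (2 * m) (2 * m)).filter (fun l =>
        ε ≤ |(topCnt T l : ℝ) / (2 * (m : ℝ)) - (ℓ ⬝ᵥ ((Matrix.of fun c d : Fin (2 * T) =>
              ∑' n : ℕ, ∑ l ∈ LMset T n (n : ℤ) (c : ℕ) (d : ℕ), (topCnt T l.tail : ℝ) * wD T (stripYT T) l) *ᵥ u)) /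
            (ℓ ⬝ᵥ ((Matrix.of fun a b : Fin (2 * T) => ∑' n : ℕ, (n : ℝ) * LMM T n (n : ℤ) (stripYT T) a b) *ᵥ u))|),
          hexCriticalFugacity ^ l.length * stripYT T ^ topCnt T l) / betaLenSum T (2 * m) (stripYT T)) atTop (𝓝 0) := by
  set θ : ℝ := (ℓ ⬝ᵥ ((Matrix.of fun c d : Fin (2 * T) =>
      ∑' n : ℕ, ∑ l ∈ LMset T n (n : ℤ) (c : ℕ) (d : ℕ), (topCnt T l.tail : ℝ) * wD T (stripYT T) l) *ᵥ u)) /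
    (ℓ ⬝ᵥ ((Matrix.of fun a b : Fin (2 * T) => ∑' n : ℕ, (n : ℝ) * LMM T n (n : ℤ) (stripYT T) a b) *ᵥ u)) with hθ
  have hV := tendsto_beta_contacts_variance hT hu0 hℓ0 hu hℓ hC2
  rw [← hθ] at hV
  have hyT : 0 < stripYT T := stripYT_pos (by omega)
  have hx := hexCriticalFugacity_pos_lt_one.1.le
  have hw0 : ∀ l : List HV, 0 ≤ hexCriticalFugacity ^ l.length * stripYT T ^ topCnt T l := fun l =>
    mul_nonneg (pow_nonneg hx _) (pow_nonneg hyT.le _)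
  have hup := hV.const_mul (1 / ε ^ 2)
  rw [mul_zero] at hup
  refine tendsto_of_tendsto_of_tendsto_of_le_of_le' tendsto_const_nhds hup ?_ ?_
  · filter_upwards with m
    exact div_nonneg (sum_nonneg fun l _ => hw0 l) (sum_nonneg fun l _ => hw0 l)
  · filter_upwards [eventually_ge_atTop 1] with m hm
    have hn : (0 : ℝ) < 2 * (m : ℝ) := by exact_mod_cast (show 0 < 2 * m by omega)
    set n : ℝ := 2 * (m : ℝ) with hn'
    set S := betaLen T (2 * m) (2 * m) with hS
    set w := fun l : List HV => hexCriticalFugacity ^ l.length * stripYT T ^ topCnt T l with hw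
    have hB0 : 0 ≤ betaLenSum T (2 * m) (stripYT T) := sum_nonneg fun l _ => hw0 l
    have hpt : ∀ l ∈ S, ε ≤ |(topCnt T l : ℝ) / n - θ| → w l ≤ (1 / ε ^ 2) * (((topCnt T l : ℝ) - θ * n) ^ 2 * w l / n ^ 2) := by
      intro l _ hbad
      have hwl : 0 ≤ w l := hw0 l
      have hdev : ε ^ 2 ≤ ((topCnt T l : ℝ) / n - θ) ^ 2 := by
        calc ε ^ 2 = |ε| ^ 2 := by rw [abs_of_pos hε]
          _ ≤ |(topCnt T l : ℝ) / n - θ| ^ 2 := pow_le_pow_left₀ (abs_nonneg ε) (by rwa [abs_of_pos hε]) 2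
          _ = ((topCnt T l : ℝ) / n - θ) ^ 2 := sq_abs _
      have hid : ((topCnt T l : ℝ) - θ * n) ^ 2 * w l / n ^ 2 = ((topCnt T l : ℝ) / n - θ) ^ 2 * w l := by
        field_simp
      have h1 : ε ^ 2 * w l ≤ ((topCnt T l : ℝ) / n - θ) ^ 2 * w l := mul_le_mul_of_nonneg_right hdev hwl
      calc w l = (1 / ε ^ 2) * (ε ^ 2 * w l) := by field_simp
        _ ≤ (1 / ε ^ 2) * (((topCnt T l : ℝ) / n - θ) ^ 2 * w l) := mul_le_mul_of_nonneg_left h1 (by positivity)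
        _ = (1 / ε ^ 2) * (((topCnt T l : ℝ) - θ * n) ^ 2 * w l / n ^ 2) := by rw [hid]
    calc (∑ l ∈ S.filter (fun l => ε ≤ |(topCnt T l : ℝ) / n - θ|), w l) / betaLenSum T (2 * m) (stripYT T)
        ≤ (∑ l ∈ S.filter (fun l => ε ≤ |(topCnt T l : ℝ) / n - θ|),
            (1 / ε ^ 2) * (((topCnt T l : ℝ) - θ * n) ^ 2 * w l / n ^ 2)) / betaLenSum T (2 * m) (stripYT T) := by
          refine div_le_div_of_nonneg_right (sum_le_sum fun l hl => ?_) hB0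
          rw [mem_filter] at hl
          exact hpt l hl.1 hl.2
      _ ≤ (∑ l ∈ S, (1 / ε ^ 2) * (((topCnt T l : ℝ) - θ * n) ^ 2 * w l / n ^ 2)) / betaLenSum T (2 * m) (stripYT T) := by
          refine div_le_div_of_nonneg_right (sum_le_sum_of_subset_of_nonneg (filter_subset _ _) fun l _ _ => ?_) hB0
          have := hw0 l
          positivity
      _ = (1 / ε ^ 2) * ((∑ l ∈ S, ((topCnt T l : ℝ) - θ * n) ^ 2 * w l) / (n ^ 2 * betaLenSum T (2 * m) (stripYT T))) := by
          rw [← mul_sum, ← Finset.sum_div, mul_div_assoc, div_div]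

/-- ★★★★ **WIDTH TWO: THE SURFACE CONTACTS OF A LONG CRITICAL β-WALK OF `S₂` CONCENTRATE AT `((3 − √2)/4)·n`** — unconditional.  For every `ε > 0`:
`(Σ_{β-walks ω of S₂ with 2m vertices and |#top(ω)/(2m) − (3 − √2)/4| ≥ ε} x_c^{2m} y₂^{#top(ω)}) / bℓ₂(2m) ⟶ 0`
(the weak law above with «CONTACT-LLN»'s `widthTwo_summable_contactSqIrr` and the closed-form Perron data of «WIDTH-TWO-KERNEL» #715:
`⟨ℓ, C̄_M u⟩ = 7`, `⟨ℓ, M̄_len u⟩ = 20 − 8x_c²`, `7·4 = (3 − √2)(20 − 8x_c²)`). [cite: BeatonBousquetMelouDeGierDuminilCopinGuttmann2014, Corollary 8 (the strip at (x_c, y_T)); Feller1968, XIII.6; lane «pcv-sawmu» a-p2 g24 — own result, not in print] -/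
theorem widthTwo_beta_contacts_deviation {ε : ℝ} (hε : 0 < ε) :
    Tendsto (fun m : ℕ => (∑ l ∈ (betaLen 2 (2 * m) (2 * m)).filter (fun l =>
        ε ≤ |(topCnt 2 l : ℝ) / (2 * (m : ℝ)) - (3 - Real.sqrt 2) / 4|),
          hexCriticalFugacity ^ l.length * stripYT 2 ^ topCnt 2 l) / betaLenSum 2 (2 * m) (stripYT 2)) atTop (𝓝 0) := by
  have h := tendsto_beta_contacts_deviation (T := 2) le_rfl W2.uTwo_pos W2.ellTwo_pos W2.Iinf_two_fixed.1 W2.Iinf_two_fixed.2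
    widthTwo_summable_contactSqIrr hε
  have hval : (W2.ellTwo ⬝ᵥ ((Matrix.of fun c d : Fin (2 * 2) =>
      ∑' n : ℕ, ∑ l ∈ LMset 2 n (n : ℤ) (c : ℕ) (d : ℕ), (topCnt 2 l.tail : ℝ) * wD 2 (stripYT 2) l) *ᵥ W2.uTwo)) /
      (W2.ellTwo ⬝ᵥ ((Matrix.of fun a b : Fin (2 * 2) => ∑' n : ℕ, (n : ℝ) * LMM 2 n (n : ℤ) (stripYT 2) a b) *ᵥ W2.uTwo)) =
      (3 - Real.sqrt 2) / 4 := by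
    rw [W2.contactMomentMatrix_two_eq, W2.lengthMomentMatrix_two_eq, W2.contact_scalar_two.1, W2.perron_scalars_two.2]
    have hpos : 0 < 20 - 8 * hexCriticalFugacity ^ 2 := by nlinarith [W2.xc_sq_bounds.2]
    have h4 := W2.contact_scalar_two.2
    rw [W2.contact_scalar_two.1, W2.perron_scalars_two.2] at h4
    rw [div_eq_div_iff hpos.ne' (by norm_num : (4 : ℝ) ≠ 0)]
    linarith
  rw [hval] at h
  exact h

end Law

end HV

end Literature.Probability.RandomPlanarGeometry.SAW
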